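import Summits.CriticalPhenomena.PercolationContinuityZ3.Theorems.Transplant.SkelPhiFaceNegBTC4
import HarnessLib

/-!
# N1 ({±1} node), (F) column — THE WRAPPER'S PROVIDER LAYER B4, chain v8 (hp-8 g36), TRANSPOSED CASES: `NegB.faceOblRM_negBTC₄d/₄t` (case `s` and the shared lemma: SkelPhiFaceNegBTC4)
# = `faceOblRM_negBTC₃s/₃d/₃t` (layer (b) B3, chain v9: the y′-face numbers read their own half-widths `qB′ qB₃′`) with the keystone's PER-CENTRE NUMBERS `numsX/numsY` and their chain-budget caps `hnFx/hnFy`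
# DISCHARGED from LINEAR FLOORS: at every admissible contact cell the count-exposing constructors `Skelφ.numsX_of_floors₂E/numsY_of_floors₂E`
# (∘ `faceRunNumsX4_mkE/Y4_mkE`) read the contact's cell through the frame box (`Skelφ.cell_of_frame_box`, rooms `hroomF_RA` at the band
# `E := RlevA + reachA`, transverse offset `kE := kFF₂ (E − 1) du.1`), the near zone through the two lattice functionals (`zone_fine_le_of_lam` ∘ FaceLamA
# `hkF0_RA/hkF1_RA` ∘ `faceLam_zone`), the fine lattice of record (`prFA_*`, `D_eq_A_sq_mulA`, `modulus_top`, `lip_ψ/weakSteps_ψ` ∘ `lip_φL/steps_φL`),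
# the realised radii handed down by the v8 keystone (`L′ ≤ rM`, `L′ ≤ rE`); `numsX := Classical.choose …`, the caps by `choose_spec` from the
# floors-side caps `NrF + N3F + 2 ≤ nFA K₀`.  LEFT (the glue's inputs, per bridge case): the hop sides `σhF`, the half-widths `qB qB₃`, the choice
# functions `yLF NrF N3F σTF` (x-faces) / `yLF′ NrF′ N3F′ σTF′` (y′-faces), the floors `floorsX : … → Skelφ.FloorsX2 …` / `floorsY : … → Skelφ.FloorsY2 …`
# (M3: p3/stmt/p1 lineages), the caps, and `hmx hex hSF16 hCF`.
builds on p205010 (kernel theorem, internal audit signed; external expert review pending) — nothing in this file uses p205010; NOTHING is claimed about the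
open node `SamePDropOfSkeletonNeg₁`.
Lane `prim-bschramm`, seat `prim-hp-8` (gen 36); helper file (`--supports stmt-CriticalPhenomena-4575 --as helper`); slot-ledger ζ′ v1.
[cite: KozmaNitzan2024, §4 Lemma 10 (pp. 17–21), Lemma 12 (pp. 23–25)] [cite: MartineauTassion2017, §4.3 Lemma 4.2]
-/


noncomputable section

open scoped Classical ENNReal

namespace Summit.CriticalPhenomena.PercolationContinuityZ3.Theorems.Transplant

namespace PlanarSkeletonNeg

namespace NegB

open MeasureTheory Literature.Probability.Percolation Literature.Probability.LatticeModels SimpleGraph KNCells KNLevels GadgetSystem Contour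
open Literature.Probability.Percolation.KozmaNitzan
open Literature.Probability.Percolation.KozmaNitzan.Cells (oth sgOf sgOf_sign stepVec_apply_fst)
open Literature.Barriers.CriticalPhenomena (graphBall mem_graphBall_self graphBall_mono)
open BoxProdZ2 (ConcRadiiG Erad Frad nQ nS)
open ChainPlanar ChainPara
open Skel (winGraph routeW excess WinStepData)
open SkelI (tanOff)
open TwoAxis.Para (modulus detD rep₂)
open SkelConc (Consts)
open Skelφ
open Neg
open Skelφ (oriφ trφ pgramPrismFin pgSideHalfW pgTopPieceW)

variable {κ : Consts} {V : Type} [DecidableEq V] [Countable V] {G : SimpleGraph V} [G.LocallyFinite] {Φ : PlanarSkeletonNeg G} {t : V}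
  {p : unitInterval} {gv fv : Neg.FSlot} {Sv : SSlot} {hC : Φ.CylSubcritical p} {Pv : PSlot} {O : Skelφ.StepI.OutO V} {q : unitInterval}

set_option maxHeartbeats 1600000 in
/-- **The provider layer B4 of the (F) wrapper, case `o_F ≠ o_L`, bridge = side half of `trφ φL`**: the per-centre numbers and their caps from the linear floors (see the module docstring).
[cite: KozmaNitzan2024, §4 Lemma 12 (pp. 23–25)] -/
theorem faceOblRM_negBTC₄d (cF : ℕ) (gx fx : Neg.FSlot) (Px : PSlot) (ex mx : GSlot)
    (hAt : (choiceAtOTA κ Φ t p (KS.gT 0 gx) (KS.fT 0 fx) (SUA ex mx) hC (KS.PR 0 Px)).AtQO O q)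
    (hmx : (prFA κ Φ t p O.merged (gOf κ Φ t p O (KS.gT 0 gx)) (fOf κ Φ t p O (KS.fT 0 fx))).mF (fcellsA κ Φ t p O.merged (gOf κ Φ t p O (KS.gT 0 gx)) (fOf κ Φ t p O (KS.fT 0 fx))) ≤ ((mx κ Φ t p O.merged (gOf κ Φ t p O (KS.gT 0 gx)) (fOf κ Φ t p O (KS.fT 0 fx)) : ℕ) : ℤ))
    (hex : exA κ Φ t p O.merged (gOf κ Φ t p O (KS.gT 0 gx)) (fOf κ Φ t p O (KS.fT 0 fx)) ≤ ex κ Φ t p O.merged (gOf κ Φ t p O (KS.gT 0 gx)) (fOf κ Φ t p O (KS.fT 0 fx)) ∧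
      KS.r₀A Φ t O.merged 0 (O.merged.R (O.merged.scale t (KS.MBF κ Φ t p O.merged cF 0) (KS.nBF κ Φ t p O.merged cF 0))) + 1 ≤ ex κ Φ t p O.merged (gOf κ Φ t p O (KS.gT 0 gx)) (fOf κ Φ t p O (KS.fT 0 fx)))
    (hSF16 : 16 * KS.SF κ Φ t p O.merged cF 0 ≤ ML κ Φ t p O.merged (gOf κ Φ t p O (KS.gT 0 gx)))
    (hPx : (KS.MBF κ Φ t p O.merged cF 0, KS.nBF κ Φ t p O.merged cF 0) ∈ (KS.PR 0 Px κ Φ t p O.merged).1)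
    (htr : oriφ Φ.φ (O.ori t (KS.MBF κ Φ t p O.merged cF 0) (KS.nBF κ Φ t p O.merged cF 0)) = trφ (φL κ Φ t p O.D O.DT O.ori (gOf κ Φ t p O (KS.gT 0 gx)) (fOf κ Φ t p O (KS.fT 0 fx))))(h1 : Φ.types = {t}) (hp0 : 0 < (p : ℝ)) (hp1 : (p : ℝ) < 1)
      (σhF : MDir → ℤ) (hσhF : ∀ du : MDir, σhF du = 1 ∨ σhF du = -1)
     (qB qB₃ qB' qB₃' : ℕ)
       (hCF : ChainFactL NegB.LfA G Φ.Δ κ)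
    -- the x-face / y′-face choice functions (landing origin, along count, tangential count, tangential sign), per contact cell
    (yLF : Site 2 → MDir → ℕ → Site 2 → Site 2) (NrF N3F : Site 2 → MDir → ℕ → Site 2 → ℕ) (σTF : Site 2 → MDir → ℕ → Site 2 → ℤ)
    (yLF' : Site 2 → MDir → ℕ → Site 2 → Site 2) (NrF' N3F' : Site 2 → MDir → ℕ → Site 2 → ℕ) (σTF' : Site 2 → MDir → ℕ → Site 2 → ℤ)
    -- THE LINEAR FLOORS at every admissible contact cell (M3), band `E := RlevA + reachA`, transverse offset `kE := kFF₂ (E − 1) du.1`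
    (floorsX : ∀ (x : Site 2) (du : MDir) (j : ℕ) (z : Site 2), du.1 = 0 → j < (fcellsA κ Φ t p O.merged (gOf κ Φ t p O (KS.gT 0 gx)) (fOf κ Φ t p O (KS.fT 0 fx))).K → ((fcellsA κ Φ t p O.merged (gOf κ Φ t p O (KS.gT 0 gx)) (fOf κ Φ t p O (KS.fT 0 fx))).faceL du.1 j : ℤ) - (((KS.RlevA κ Φ t p O.merged 0 + KS.reachA t O.merged 0) : ℕ) : ℤ) ≤ (fcellsA κ Φ t p O.merged (gOf κ Φ t p O (KS.gT 0 gx)) (fOf κ Φ t p O (KS.fT 0 fx))).lev du x z →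
      (fcellsA κ Φ t p O.merged (gOf κ Φ t p O (KS.gT 0 gx)) (fOf κ Φ t p O (KS.fT 0 fx))).lev du x z ≤ (fcellsA κ Φ t p O.merged (gOf κ Φ t p O (KS.gT 0 gx)) (fOf κ Φ t p O (KS.fT 0 fx))).faceL du.1 j + (((KS.RlevA κ Φ t p O.merged 0 + KS.reachA t O.merged 0) : ℕ) : ℤ) → |z (oth du.1) - (fcellsA κ Φ t p O.merged (gOf κ Φ t p O (KS.gT 0 gx)) (fOf κ Φ t p O (KS.fT 0 fx))).cen x (oth du.1)| ≤ ((prFA κ Φ t p O.merged (gOf κ Φ t p O (KS.gT 0 gx)) (fOf κ Φ t p O (KS.fT 0 fx))).kFF₂ (fcellsA κ Φ t p O.merged (gOf κ Φ t p O (KS.gT 0 gx)) (fOf κ Φ t p O (KS.fT 0 fx))) ((KS.RlevA κ Φ t p O.merged 0 + KS.reachA t O.merged 0) - 1) du.1) →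
      Skelφ.FloorsX2 (prFA κ Φ t p O.merged (gOf κ Φ t p O (KS.gT 0 gx)) (fOf κ Φ t p O (KS.fT 0 fx))) (nL κ Φ t p O.merged (gOf κ Φ t p O (KS.gT 0 gx)) (fOf κ Φ t p O (KS.fT 0 fx))) (((fcellsA κ Φ t p O.merged (gOf κ Φ t p O (KS.gT 0 gx)) (fOf κ Φ t p O (KS.fT 0 fx))).s 0 : ℕ) : ℤ) (((fcellsA κ Φ t p O.merged (gOf κ Φ t p O (KS.gT 0 gx)) (fOf κ Φ t p O (KS.fT 0 fx))).s 1 : ℕ) : ℤ) (modulus (nL κ Φ t p O.merged (gOf κ Φ t p O (KS.gT 0 gx)) (fOf κ Φ t p O (KS.fT 0 fx))) (hL κ Φ t p O.merged (gOf κ Φ t p O (KS.gT 0 gx)) (fOf κ Φ t p O (KS.fT 0 fx))) (vL κ Φ t p O.merged (gOf κ Φ t p O (KS.gT 0 gx)) (fOf κ Φ t p O (KS.fT 0 fx))) (vβL κ Φ t p O.merged (gOf κ Φ t p O (KS.gT 0 gx)) (fOf κ Φ t p O (KS.fT 0 fx)))) (((nL κ Φ t p O.merged (gOf κ Φ t p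 O (KS.gT 0 gx)) (fOf κ Φ t p O (KS.fT 0 fx))) : ℕ) : ℤ) (ℓL κ Φ t p O.merged (gOf κ Φ t p O (KS.gT 0 gx)) (fOf κ Φ t p O (KS.fT 0 fx))) (fcellsA κ Φ t p O.merged (gOf κ Φ t p O (KS.gT 0 gx)) (fOf κ Φ t p O (KS.fT 0 fx))) (b0TA κ Φ t p O.merged (gOf κ Φ t p O (KS.gT 0 gx)) (fOf κ Φ t p O (KS.fT 0 fx))) x du j (3 : ℤ) (Skelφ.Prm.Lp (SUA ex mx κ Φ t p O.merged (gOf κ Φ t p O (KS.gT 0 gx)) (fOf κ Φ t p O (KS.fT 0 fx)) q)) (Mu O.merged) z (fun i : Fin 2 => if i = 0 then KS.kF₀A κ Φ t p O.merged cF 0 (gOf κ Φ t p O (KS.gT 0 gx)) (fOf κ Φ t p O (KS.fT 0 fx)) else KS.kF₁A κ Φ t p O.merged cF 0 (gOf κ Φ t p O (KS.gT 0 gx)) (fOf κ Φ t p O (KS.fT 0 fx))) ((fun σ' : ℤ => KS.BFd κ Φ t p O.merged cF 0 (gOf κ Φ t p O (KS.gT 0 gx)) (fOf κ Φ t p O (KS.fT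 0 fx)) σ') (sgOf du)) (KS.RA' κ Φ t p O.merged 0) qB (KS.RA' κ Φ t p O.merged 0) qB₃ (yLF x du j z) (NrF x du j z) (N3F x du j z) (σTF x du j z))
    (floorsY : ∀ (x : Site 2) (du : MDir) (j : ℕ) (z : Site 2), du.1 = 1 → j < (fcellsA κ Φ t p O.merged (gOf κ Φ t p O (KS.gT 0 gx)) (fOf κ Φ t p O (KS.fT 0 fx))).K → ((fcellsA κ Φ t p O.merged (gOf κ Φ t p O (KS.gT 0 gx)) (fOf κ Φ t p O (KS.fT 0 fx))).faceL du.1 j : ℤ) - (((KS.RlevA κ Φ t p O.merged 0 + KS.reachA t O.merged 0) : ℕ) : ℤ) ≤ (fcellsA κ Φ t p O.merged (gOf κ Φ t p O (KS.gT 0 gx)) (fOf κ Φ t p O (KS.fT 0 fx))).lev du x z →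
      (fcellsA κ Φ t p O.merged (gOf κ Φ t p O (KS.gT 0 gx)) (fOf κ Φ t p O (KS.fT 0 fx))).lev du x z ≤ (fcellsA κ Φ t p O.merged (gOf κ Φ t p O (KS.gT 0 gx)) (fOf κ Φ t p O (KS.fT 0 fx))).faceL du.1 j + (((KS.RlevA κ Φ t p O.merged 0 + KS.reachA t O.merged 0) : ℕ) : ℤ) → |z (oth du.1) - (fcellsA κ Φ t p O.merged (gOf κ Φ t p O (KS.gT 0 gx)) (fOf κ Φ t p O (KS.fT 0 fx))).cen x (oth du.1)| ≤ ((prFA κ Φ t p O.merged (gOf κ Φ t p O (KS.gT 0 gx)) (fOf κ Φ t p O (KS.fT 0 fx))).kFF₂ (fcellsA κ Φ t p O.merged (gOf κ Φ t p O (KS.gT 0 gx)) (fOf κ Φ t p O (KS.fT 0 fx))) ((KS.RlevA κ Φ t p O.merged 0 + KS.reachA t O.merged 0) - 1) du.1) →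
      Skelφ.FloorsY2 (prFA κ Φ t p O.merged (gOf κ Φ t p O (KS.gT 0 gx)) (fOf κ Φ t p O (KS.fT 0 fx))) (nL κ Φ t p O.merged (gOf κ Φ t p O (KS.gT 0 gx)) (fOf κ Φ t p O (KS.fT 0 fx))) (((fcellsA κ Φ t p O.merged (gOf κ Φ t p O (KS.gT 0 gx)) (fOf κ Φ t p O (KS.fT 0 fx))).s 0 : ℕ) : ℤ) (((fcellsA κ Φ t p O.merged (gOf κ Φ t p O (KS.gT 0 gx)) (fOf κ Φ t p O (KS.fT 0 fx))).s 1 : ℕ) : ℤ) (modulus (nL κ Φ t p O.merged (gOf κ Φ t p O (KS.gT 0 gx)) (fOf κ Φ t p O (KS.fT 0 fx))) (hL κ Φ t p O.merged (gOf κ Φ t p O (KS.gT 0 gx)) (fOf κ Φ t p O (KS.fT 0 fx))) (vL κ Φ t p O.merged (gOf κ Φ t p O (KS.gT 0 gx)) (fOf κ Φ t p O (KS.fT 0 fx))) (vβL κ Φ t p O.merged (gOf κ Φ t p O (KS.gT 0 gx)) (fOf κ Φ t p O (KS.fT 0 fx)))) (((nL κ Φ t p O.merged (gOf κ Φ t p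 O (KS.gT 0 gx)) (fOf κ Φ t p O (KS.fT 0 fx))) : ℕ) : ℤ) (ℓL κ Φ t p O.merged (gOf κ Φ t p O (KS.gT 0 gx)) (fOf κ Φ t p O (KS.fT 0 fx))) (fcellsA κ Φ t p O.merged (gOf κ Φ t p O (KS.gT 0 gx)) (fOf κ Φ t p O (KS.fT 0 fx))) (b0TA κ Φ t p O.merged (gOf κ Φ t p O (KS.gT 0 gx)) (fOf κ Φ t p O (KS.fT 0 fx))) x du j (3 : ℤ) (Skelφ.Prm.Lp (SUA ex mx κ Φ t p O.merged (gOf κ Φ t p O (KS.gT 0 gx)) (fOf κ Φ t p O (KS.fT 0 fx)) q)) (Mu O.merged) z (fun i : Fin 2 => if i = 0 then KS.kF₀A κ Φ t p O.merged cF 0 (gOf κ Φ t p O (KS.gT 0 gx)) (fOf κ Φ t p O (KS.fT 0 fx)) else KS.kF₁A κ Φ t p O.merged cF 0 (gOf κ Φ t p O (KS.gT 0 gx)) (fOf κ Φ t p O (KS.fT 0 fx))) (σhF du) ((fun σ' : ℤ => KS.BFd κ Φ t p O.merged cF 0 (gOf κ Φ t p O (KS.gT 0 gx)) (fOf κ Φ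 t p O (KS.fT 0 fx)) σ') (σhF du)) (KS.RA' κ Φ t p O.merged 0) qB' (KS.RA' κ Φ t p O.merged 0) qB₃' (yLF' x du j z) (NrF' x du j z) (N3F' x du j z) (σTF' x du j z))
    -- the stride counts within the chain budget
    (hcapX : ∀ (x : Site 2) (du : MDir) (j : ℕ) (z : Site 2), NrF x du j z + N3F x du j z + 2 ≤ NegB.nFA κ.K₀)
    (hcapY : ∀ (x : Site 2) (du : MDir) (j : ℕ) (z : Site 2), NrF' x du j z + N3F' x du j z + 2 ≤ NegB.nFA κ.K₀) :
    Skelφ.FaceOblRM G ((choiceAtOTA κ Φ t p (KS.gT 0 gx) (KS.fT 0 fx) (SUA ex mx) hC (KS.PR 0 Px)).scheme O q)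
      ((choiceAtOTA κ Φ t p (KS.gT 0 gx) (KS.fT 0 fx) (SUA ex mx) hC (KS.PR 0 Px)).FD O q) Φ.Δ κ.δ₂ := by
  -- facts at `AtQO`
  have hAtS := atQOS_of_atQOTA hAt
  have hNL : EqNumL κ Φ t p O.merged (gOf κ Φ t p O (KS.gT 0 gx)) (fOf κ Φ t p O (KS.fT 0 fx)) := eqNumL_of_atQOTA hAt
  obtain ⟨hnL1, hℓL1⟩ := one_le_of_eqNumL κ Φ t p O.merged (gOf κ Φ t p O (KS.gT 0 gx)) (fOf κ Φ t p O (KS.fT 0 fx)) hNL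
  obtain ⟨hF, -, -, -⟩ := factsO_of_atQOTA hAt
  obtain ⟨-, -, -, -, hΛeq⟩ := hF.seed
  have hZ : ∀ c, (↑(O.merged.Λ c (Mu O.merged)) : Set V) ⊆ Skelφ.cyl (φL κ Φ t p O.D O.DT O.ori (gOf κ Φ t p O (KS.gT 0 gx)) (fOf κ Φ t p O (KS.fT 0 fx))) c (Mu O.merged) := fun c => by
    unfold NegB.φL; rw [Skelφ.cyl_oriφ, hΛeq]; exact Skelφ.fatSeq_subset_cyl Φ.frame hC c _
  have hZb : ∀ c', ∀ v ∈ O.merged.Λ c' (Mu O.merged), (φL κ Φ t p O.D O.DT O.ori (gOf κ Φ t p O (KS.gT 0 gx)) (fOf κ Φ t p O (KS.fT 0 fx))) v - (φL κ Φ t p O.D O.DT O.ori (gOf κ Φ t p O (KS.gT 0 gx)) (fOf κ Φ t p O (KS.fT 0 fx))) c' ∈ box 2 (Mu O.merged) := fun c' v hv =>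
    (Skelφ.mem_cyl (φL κ Φ t p O.D O.DT O.ori (gOf κ Φ t p O (KS.gT 0 gx)) (fOf κ Φ t p O (KS.fT 0 fx))) c' (Mu O.merged) v).1 (hZ c' (Finset.mem_coe.2 hv))
  have hRA := KS.RA'_eq κ Φ t p O.merged 0
  -- the fine lattice of record
  obtain ⟨hc₀, hc₁⟩ := prFA_c_pos κ Φ t p O.merged (gOf κ Φ t p O (KS.gT 0 gx)) (fOf κ Φ t p O (KS.fT 0 fx))
  have hD : 0 < (prFA κ Φ t p O.merged (gOf κ Φ t p O (KS.gT 0 gx)) (fOf κ Φ t p O (KS.fT 0 fx))).D := prFA_D_pos κ Φ t p O.merged (gOf κ Φ t p O (KS.gT 0 gx)) (fOf κ Φ t p O (KS.fT 0 fx)) hNL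
  have hDd := prFA_D κ Φ t p O.merged (gOf κ Φ t p O (KS.gT 0 gx)) (fOf κ Φ t p O (KS.fT 0 fx))
  have hn : (prFA κ Φ t p O.merged (gOf κ Φ t p O (KS.gT 0 gx)) (fOf κ Φ t p O (KS.fT 0 fx))).n = (nL κ Φ t p O.merged (gOf κ Φ t p O (KS.gT 0 gx)) (fOf κ Φ t p O (KS.fT 0 fx))) := (prFA_fields κ Φ t p O.merged (gOf κ Φ t p O (KS.gT 0 gx)) (fOf κ Φ t p O (KS.fT 0 fx))).2.1
  have hA : 0 < (prFA κ Φ t p O.merged (gOf κ Φ t p O (KS.gT 0 gx)) (fOf κ Φ t p O (KS.fT 0 fx))).A := (Aof_pos κ).1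
  have hL0' : (prFA κ Φ t p O.merged (gOf κ Φ t p O (KS.gT 0 gx)) (fOf κ Φ t p O (KS.fT 0 fx))).c₀ * (prFA κ Φ t p O.merged (gOf κ Φ t p O (KS.gT 0 gx)) (fOf κ Φ t p O (KS.fT 0 fx))).L 0 ≤ (prFA κ Φ t p O.merged (gOf κ Φ t p O (KS.gT 0 gx)) (fOf κ Φ t p O (KS.fT 0 fx))).D := by have h : (prFA κ Φ t p O.merged (gOf κ Φ t p O (KS.gT 0 gx)) (fOf κ Φ t p O (KS.fT 0 fx))).c₀ * (prFA κ Φ t p O.merged (gOf κ Φ t p O (KS.gT 0 gx)) (fOf κ Φ t p O (KS.fT 0 fx))).L 0 + 2 ≤ (prFA κ Φ t p O.merged (gOf κ Φ t p O (KS.gT 0 gx)) (fOf κ Φ t p O (KS.fT 0 fx))).D := cL_upperA κ Φ t p O.merged (gOf κ Φ t p O (KS.gT 0 gx)) (fOf κ Φ t p O (KS.fT 0 fx)) hNL 0; omega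
  have hL1' : (prFA κ Φ t p O.merged (gOf κ Φ t p O (KS.gT 0 gx)) (fOf κ Φ t p O (KS.fT 0 fx))).c₁ * (prFA κ Φ t p O.merged (gOf κ Φ t p O (KS.gT 0 gx)) (fOf κ Φ t p O (KS.fT 0 fx))).L 1 ≤ (prFA κ Φ t p O.merged (gOf κ Φ t p O (KS.gT 0 gx)) (fOf κ Φ t p O (KS.fT 0 fx))).D := by have h : (prFA κ Φ t p O.merged (gOf κ Φ t p O (KS.gT 0 gx)) (fOf κ Φ t p O (KS.fT 0 fx))).c₁ * (prFA κ Φ t p O.merged (gOf κ Φ t p O (KS.gT 0 gx)) (fOf κ Φ t p O (KS.fT 0 fx))).L 1 + 2 ≤ (prFA κ Φ t p O.merged (gOf κ Φ t p O (KS.gT 0 gx)) (fOf κ Φ t p O (KS.fT 0 fx))).D := cL_upperA κ Φ t p O.merged (gOf κ Φ t p O (KS.gT 0 gx)) (fOf κ Φ t p O (KS.fT 0 fx)) hNL 1; omega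
  have hlipψ : Lip G ((prFA κ Φ t p O.merged (gOf κ Φ t p O (KS.gT 0 gx)) (fOf κ Φ t p O (KS.fT 0 fx))).ψ (φL κ Φ t p O.D O.DT O.ori (gOf κ Φ t p O (KS.gT 0 gx)) (fOf κ Φ t p O (KS.fT 0 fx))) t) := (prFA κ Φ t p O.merged (gOf κ Φ t p O (KS.gT 0 gx)) (fOf κ Φ t p O (KS.fT 0 fx))).lip_ψ (lip_φL κ Φ t p O.D O.DT O.ori (gOf κ Φ t p O (KS.gT 0 gx)) (fOf κ Φ t p O (KS.fT 0 fx))) t hc₀.le hc₁.le hD hL0' hL1'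
  have hws : WeakSteps G ((prFA κ Φ t p O.merged (gOf κ Φ t p O (KS.gT 0 gx)) (fOf κ Φ t p O (KS.fT 0 fx))).ψ (φL κ Φ t p O.D O.DT O.ori (gOf κ Φ t p O (KS.gT 0 gx)) (fOf κ Φ t p O (KS.fT 0 fx))) t) := (prFA κ Φ t p O.merged (gOf κ Φ t p O (KS.gT 0 gx)) (fOf κ Φ t p O (KS.fT 0 fx))).weakSteps_ψ (steps_φL κ Φ t p O.D O.DT O.ori (gOf κ Φ t p O (KS.gT 0 gx)) (fOf κ Φ t p O (KS.fT 0 fx))) t hc₀.le hc₁.le hD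
  have hnz : ∀ du : MDir, (prFA κ Φ t p O.merged (gOf κ Φ t p O (KS.gT 0 gx)) (fOf κ Φ t p O (KS.fT 0 fx))).lvGen du.1 ((prFA κ Φ t p O.merged (gOf κ Φ t p O (KS.gT 0 gx)) (fOf κ Φ t p O (KS.fT 0 fx))).bOf du.1) ≠ 0 := fun du => (prFA κ Φ t p O.merged (gOf κ Φ t p O (KS.gT 0 gx)) (fOf κ Φ t p O (KS.fT 0 fx))).lvGen_bOf_ne_zero du.1 ((prFA κ Φ t p O.merged (gOf κ Φ t p O (KS.gT 0 gx)) (fOf κ Φ t p O (KS.fT 0 fx))).lvGen_ne_zero_of_detD_pos hDd hD du.1)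
  obtain ⟨hc0, hc1⟩ := prFA_c_eq κ Φ t p O.merged (gOf κ Φ t p O (KS.gT 0 gx)) (fOf κ Φ t p O (KS.fT 0 fx))
  have hκ₀ : (0 : ℤ) ≤ (((fcellsA κ Φ t p O.merged (gOf κ Φ t p O (KS.gT 0 gx)) (fOf κ Φ t p O (KS.fT 0 fx))).s 0 : ℕ) : ℤ) := Nat.cast_nonneg _
  have hmod : modulus (nL κ Φ t p O.merged (gOf κ Φ t p O (KS.gT 0 gx)) (fOf κ Φ t p O (KS.fT 0 fx))) (prFA κ Φ t p O.merged (gOf κ Φ t p O (KS.gT 0 gx)) (fOf κ Φ t p O (KS.fT 0 fx))).h (prFA κ Φ t p O.merged (gOf κ Φ t p O (KS.gT 0 gx)) (fOf κ Φ t p O (KS.fT 0 fx))).vα (prFA κ Φ t p O.merged (gOf κ Φ t p O (KS.gT 0 gx)) (fOf κ Φ t p O (KS.fT 0 fx))).vβ = modulus (nL κ Φ t p O.merged (gOf κ Φ t p O (KS.gT 0 gx)) (fOf κ Φ t p O (KS.fT 0 fx))) (hL κ Φ t p O.merged (gOf κ Φ t p O (KS.gT 0 gx)) (fOf κ Φ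 t p O (KS.fT 0 fx))) (vL κ Φ t p O.merged (gOf κ Φ t p O (KS.gT 0 gx)) (fOf κ Φ t p O (KS.fT 0 fx))) (vβL κ Φ t p O.merged (gOf κ Φ t p O (KS.gT 0 gx)) (fOf κ Φ t p O (KS.fT 0 fx))) := rfl
  have hmod0 : 0 < modulus (nL κ Φ t p O.merged (gOf κ Φ t p O (KS.gT 0 gx)) (fOf κ Φ t p O (KS.fT 0 fx))) (hL κ Φ t p O.merged (gOf κ Φ t p O (KS.gT 0 gx)) (fOf κ Φ t p O (KS.fT 0 fx))) (vL κ Φ t p O.merged (gOf κ Φ t p O (KS.gT 0 gx)) (fOf κ Φ t p O (KS.fT 0 fx))) (vβL κ Φ t p O.merged (gOf κ Φ t p O (KS.gT 0 gx)) (fOf κ Φ t p O (KS.fT 0 fx))) := Skelφ.NegPrm.modulus_vβOf_pos hnL1 hℓL1 _ _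
  have hDm : (prFA κ Φ t p O.merged (gOf κ Φ t p O (KS.gT 0 gx)) (fOf κ Φ t p O (KS.fT 0 fx))).D = (prFA κ Φ t p O.merged (gOf κ Φ t p O (KS.gT 0 gx)) (fOf κ Φ t p O (KS.fT 0 fx))).A ^ 2 * modulus (nL κ Φ t p O.merged (gOf κ Φ t p O (KS.gT 0 gx)) (fOf κ Φ t p O (KS.fT 0 fx))) (hL κ Φ t p O.merged (gOf κ Φ t p O (KS.gT 0 gx)) (fOf κ Φ t p O (KS.fT 0 fx))) (vL κ Φ t p O.merged (gOf κ Φ t p O (KS.gT 0 gx)) (fOf κ Φ t p O (KS.fT 0 fx))) (vβL κ Φ t p O.merged (gOf κ Φ t p O (KS.gT 0 gx)) (fOf κ Φ t p O (KS.fT 0 fx))) := D_eq_A_sq_mulA κ Φ t p O.merged (gOf κ Φ t p O (KS.gT 0 gx)) (fOf κ Φ t p O (KS.fT 0 fx))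
  obtain ⟨hmodlo, hmodhi⟩ := modulus_top κ Φ t p O.merged (gOf κ Φ t p O (KS.gT 0 gx)) (fOf κ Φ t p O (KS.fT 0 fx)) hnL1
  -- the window radius `L′` and the band `E`
  have hfl := floors_exA κ Φ t p O.merged (gOf κ Φ t p O (KS.gT 0 gx)) (fOf κ Φ t p O (KS.fT 0 fx))
  have hLp : (ex κ Φ t p O.merged (gOf κ Φ t p O (KS.gT 0 gx)) (fOf κ Φ t p O (KS.fT 0 fx))) ≤ (Skelφ.Prm.Lp (SUA ex mx κ Φ t p O.merged (gOf κ Φ t p O (KS.gT 0 gx)) (fOf κ Φ t p O (KS.fT 0 fx)) q)) := (ex_le_Lp_UA κ Φ t p O.merged (gOf κ Φ t p O (KS.gT 0 gx)) (fOf κ Φ t p O (KS.fT 0 fx)) ex mx q).1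
  have hL' : 1 ≤ (Skelφ.Prm.Lp (SUA ex mx κ Φ t p O.merged (gOf κ Φ t p O (KS.gT 0 gx)) (fOf κ Φ t p O (KS.fT 0 fx)) q)) := le_trans (by have := hfl.2.2.1; have := hex.1; omega) hLp
  have hE1 : 1 ≤ KS.RlevA κ Φ t p O.merged 0 + KS.reachA t O.merged 0 := by unfold KS.reachA; omega
  have hroomB := fun du : MDir => room_cast_aux hE1 (hroomF_RA κ Φ t p O.merged (gOf κ Φ t p O (KS.gT 0 gx)) (fOf κ Φ t p O (KS.fT 0 fx)) hNL (KS.RlevA κ Φ t p O.merged 0 + KS.reachA t O.merged 0 - 1) du)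
  -- the F-Λ zone reading (L-F2)
  have hKC : 11 * Mu O.merged ≤ KS.reachA t O.merged 0 := by unfold KS.reachA KS.KCmax; omega
  have hMe : ((Mu O.merged : ℕ) : ℤ) ≤ (KS.eF κ Φ t p O.merged cF 0 : ℤ) := by
    have h : Mu O.merged ≤ KS.eF κ Φ t p O.merged cF 0 := by unfold KS.eF; have := hRA.1; omega
    exact_mod_cast h
  have hΛZ2 := faceLam_zone κ Φ t p O.merged cF 0 (gOf κ Φ t p O (KS.gT 0 gx)) (fOf κ Φ t p O (KS.fT 0 fx)) hNL hMe
  have hZk := Skelφ.zone_fine_le_of_lam (φ := (φL κ Φ t p O.D O.DT O.ori (gOf κ Φ t p O (KS.gT 0 gx)) (fOf κ Φ t p O (KS.fT 0 fx)))) (kA := (fun i : Fin 2 => if i = 0 then KS.kF₀A κ Φ t p O.merged cF 0 (gOf κ Φ t p O (KS.gT 0 gx)) (fOf κ Φ t p O (KS.fT 0 fx)) else KS.kF₁A κ Φ t p O.merged cF 0 (gOf κ Φ t p O (KS.gT 0 gx)) (fOf κ Φ t p O (KS.fT 0 fx)))) (prFA κ Φ t p O.merged (gOf κ Φ t p O (KS.gT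 0 gx)) (fOf κ Φ t p O (KS.fT 0 fx))) hn hD hc₀.le hc₁.le hΛZ2
    (KS.hkF0_RA κ Φ t p O.merged cF 0 (gOf κ Φ t p O (KS.gT 0 gx)) (fOf κ Φ t p O (KS.fT 0 fx)) hNL) (KS.hkF1_RA κ Φ t p O.merged cF 0 (gOf κ Φ t p O (KS.gT 0 gx)) (fOf κ Φ t p O (KS.fT 0 fx)) hNL) (fun c' => O.merged.Λ c' (Mu O.merged)) hZb
  -- the x-face numbers with their counts exposed
  have HX : ∀ (a' : ℕ) (x : Site 2) (du : MDir) (j : ℕ) (pc : ℤ) (c' : V), du.1 = 0 → j < (fcellsA κ Φ t p O.merged (gOf κ Φ t p O (KS.gT 0 gx)) (fOf κ Φ t p O (KS.fT 0 fx))).K → ∀ yF : V,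
      (prFA κ Φ t p O.merged (gOf κ Φ t p O (KS.gT 0 gx)) (fOf κ Φ t p O (KS.fT 0 fx))).ψ (φL κ Φ t p O.D O.DT O.ori (gOf κ Φ t p O (KS.gT 0 gx)) (fOf κ Φ t p O (KS.fT 0 fx))) t yF = (fcellsA κ Φ t p O.merged (gOf κ Φ t p O (KS.gT 0 gx)) (fOf κ Φ t p O (KS.fT 0 fx))).faceCen x du j → pc = relφ (φL κ Φ t p O.D O.DT O.ori (gOf κ Φ t p O (KS.gT 0 gx)) (fOf κ Φ t p O (KS.fT 0 fx))) t yF ((prFA κ Φ t p O.merged (gOf κ Φ t p O (KS.gT 0 gx)) (fOf κ Φ t p O (KS.fT 0 fx))).bOf du.1) →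
      (prFA κ Φ t p O.merged (gOf κ Φ t p O (KS.gT 0 gx)) (fOf κ Φ t p O (KS.fT 0 fx))).frame (φL κ Φ t p O.D O.DT O.ori (gOf κ Φ t p O (KS.gT 0 gx)) (fOf κ Φ t p O (KS.fT 0 fx))) t du.1 ((prFA κ Φ t p O.merged (gOf κ Φ t p O (KS.gT 0 gx)) (fOf κ Φ t p O (KS.fT 0 fx))).bOf du.1) c' ∈ Finset.Icc (loN (fcellsA κ Φ t p O.merged (gOf κ Φ t p O (KS.gT 0 gx)) (fOf κ Φ t p O (KS.fT 0 fx))) x du j pc ((fun du : MDir => ((prFA κ Φ t p O.merged (gOf κ Φ t p O (KS.gT 0 gx)) (fOf κ Φ t p O (KS.fT 0 fx))).awF₂ (fcellsA κ Φ t p O.merged (gOf κ Φ t p O (KS.gT 0 gx)) (fOf κ Φ t p O (KS.fT 0 fx))) du).toNat) du) - (((KS.RlevA κ Φ t p O.merged 0 + KS.reachA t O.merged 0) : ℕ) : Site 2)) (hiN (fcellsA κ Φ t p O.merged (gOf κ Φ t p O (KS.gT 0 gx)) (fOf κ Φ t p O (KS.fT 0 fx))) x du j pc ((fun du : MDir =>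 ((prFA κ Φ t p O.merged (gOf κ Φ t p O (KS.gT 0 gx)) (fOf κ Φ t p O (KS.fT 0 fx))).awF₂ (fcellsA κ Φ t p O.merged (gOf κ Φ t p O (KS.gT 0 gx)) (fOf κ Φ t p O (KS.fT 0 fx))) du).toNat) du) + (((KS.RlevA κ Φ t p O.merged 0 + KS.reachA t O.merged 0) : ℕ) : Site 2)) →
      c' ∈ graphBall G t ((concRadii2N (fcellsA κ Φ t p O.merged (gOf κ Φ t p O (KS.gT 0 gx)) (fOf κ Φ t p O (KS.fT 0 fx))) (Skelφ.Prm.gap ((SUA ex mx) κ Φ t p O.merged (gOf κ Φ t p O (KS.gT 0 gx)) (fOf κ Φ t p O (KS.fT 0 fx)) q)) (fun _ : ℕ => (0:ℕ)) (Skelφ.Prm.E₀ ((SUA ex mx) κ Φ t p O.merged (gOf κ Φ t p O (KS.gT 0 gx)) (fOf κ Φ t p O (KS.fT 0 fx)) q)) (Skelφ.Prm.Lp ((SUA ex mx) κ Φ t p O.merged (gOf κ Φ t p O (KS.gT 0 gx)) (fOf κ Φ t p O (KS.fT 0 fx)) q)) (offNA κ Φ t p O.merged (gOf κ Φ t p O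 (KS.gT 0 gx)) (fOf κ Φ t p O (KS.fT 0 fx)))).rE a' x du - (Skelφ.Prm.Lp (SUA ex mx κ Φ t p O.merged (gOf κ Φ t p O (KS.gT 0 gx)) (fOf κ Φ t p O (KS.fT 0 fx)) q))) →
      (Skelφ.Prm.Lp ((SUA ex mx) κ Φ t p O.merged (gOf κ Φ t p O (KS.gT 0 gx)) (fOf κ Φ t p O (KS.fT 0 fx)) q)) ≤ (concRadii2N (fcellsA κ Φ t p O.merged (gOf κ Φ t p O (KS.gT 0 gx)) (fOf κ Φ t p O (KS.fT 0 fx))) (Skelφ.Prm.gap ((SUA ex mx) κ Φ t p O.merged (gOf κ Φ t p O (KS.gT 0 gx)) (fOf κ Φ t p O (KS.fT 0 fx)) q)) (fun _ : ℕ => (0:ℕ)) (Skelφ.Prm.E₀ ((SUA ex mx) κ Φ t p O.merged (gOf κ Φ t p O (KS.gT 0 gx)) (fOf κ Φ t p O (KS.fT 0 fx)) q)) (Skelφ.Prm.Lp ((SUA ex mx) κ Φ t p O.merged (gOf κ Φ t p O (KS.gT 0 gx)) (fOf κ Φ t p O (KS.fT 0 fx)) q)) (offNA κ Φ t p O.merged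 (gOf κ Φ t p O (KS.gT 0 gx)) (fOf κ Φ t p O (KS.fT 0 fx)))).rM a' (x + stepVec du) → (Skelφ.Prm.Lp (SUA ex mx κ Φ t p O.merged (gOf κ Φ t p O (KS.gT 0 gx)) (fOf κ Φ t p O (KS.fT 0 fx)) q)) ≤ (concRadii2N (fcellsA κ Φ t p O.merged (gOf κ Φ t p O (KS.gT 0 gx)) (fOf κ Φ t p O (KS.fT 0 fx))) (Skelφ.Prm.gap ((SUA ex mx) κ Φ t p O.merged (gOf κ Φ t p O (KS.gT 0 gx)) (fOf κ Φ t p O (KS.fT 0 fx)) q)) (fun _ : ℕ => (0:ℕ)) (Skelφ.Prm.E₀ ((SUA ex mx) κ Φ t p O.merged (gOf κ Φ t p O (KS.gT 0 gx)) (fOf κ Φ t p O (KS.fT 0 fx)) q)) (Skelφ.Prm.Lp ((SUA ex mx) κ Φ t p O.merged (gOf κ Φ t p O (KS.gT 0 gx)) (fOf κ Φ t p O (KS.fT 0 fx)) q)) (offNA κ Φ t p O.merged (gOf κ Φ t p O (KS.gT 0 gx)) (fOf κ Φ t p O (KS.fT 0 fx)))).rE a' x du →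
      ∃ N : FaceRunNumsX4 G (φL κ Φ t p O.D O.DT O.ori (gOf κ Φ t p O (KS.gT 0 gx)) (fOf κ Φ t p O (KS.fT 0 fx))) ((prFA κ Φ t p O.merged (gOf κ Φ t p O (KS.gT 0 gx)) (fOf κ Φ t p O (KS.fT 0 fx))).ψ (φL κ Φ t p O.D O.DT O.ori (gOf κ Φ t p O (KS.gT 0 gx)) (fOf κ Φ t p O (KS.fT 0 fx))) t) c' (prFA κ Φ t p O.merged (gOf κ Φ t p O (KS.gT 0 gx)) (fOf κ Φ t p O (KS.fT 0 fx))).A (nL κ Φ t p O.merged (gOf κ Φ t p O (KS.gT 0 gx)) (fOf κ Φ t p O (KS.fT 0 fx))) (prFA κ Φ t p O.merged (gOf κ Φ t p O (KS.gT 0 gx)) (fOf κ Φ t p O (KS.fT 0 fx))).h (prFA κ Φ t p O.merged (gOf κ Φ t p O (KS.gT 0 gx)) (fOf κ Φ t p O (KS.fT 0 fx))).vα (prFA κ Φ t p O.merged (gOf κ Φ t p O (KS.gT 0 gx)) (fOf κ Φ t p O (KS.fT 0 fx))).vβ (prFA κ Φ t p O.merged (gOf κ Φ t p O (KS.gT 0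 gx)) (fOf κ Φ t p O (KS.fT 0 fx))).c₀ (prFA κ Φ t p O.merged (gOf κ Φ t p O (KS.gT 0 gx)) (fOf κ Φ t p O (KS.fT 0 fx))).c₁ (prFA κ Φ t p O.merged (gOf κ Φ t p O (KS.gT 0 gx)) (fOf κ Φ t p O (KS.fT 0 fx))).D du (sgOf du) ((fun σ' : ℤ => KS.BFd κ Φ t p O.merged cF 0 (gOf κ Φ t p O (KS.gT 0 gx)) (fOf κ Φ t p O (KS.fT 0 fx)) σ') (sgOf du)) (ℓL κ Φ t p O.merged (gOf κ Φ t p O (KS.gT 0 gx)) (fOf κ Φ t p O (KS.fT 0 fx))) (KS.RA' κ Φ t p O.merged 0) qB (KS.RA' κ Φ t p O.merged 0) qB₃ (prFA κ Φ t p O.merged (gOf κ Φ t p O (KS.gT 0 gx)) (fOf κ Φ t p O (KS.fT 0 fx))).vα (one_le_nL_of_atQOS (atQOS_of_atQOTA hAt)) (abs_vL_le_of_atQOS (atQOS_of_atQOTA hAt)) (layer_of_atQOS (atQOS_of_atQOTA hAt)) (Mu O.merged)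
        ((fcellsA κ Φ t p O.merged (gOf κ Φ t p O (KS.gT 0 gx)) (fOf κ Φ t p O (KS.fT 0 fx))).farCore x du j (3 : ℤ)) (targetMM G (φL κ Φ t p O.D O.DT O.ori (gOf κ Φ t p O (KS.gT 0 gx)) (fOf κ Φ t p O (KS.fT 0 fx))) (prFA κ Φ t p O.merged (gOf κ Φ t p O (KS.gT 0 gx)) (fOf κ Φ t p O (KS.fT 0 fx))) (fcellsA κ Φ t p O.merged (gOf κ Φ t p O (KS.gT 0 gx)) (fOf κ Φ t p O (KS.fT 0 fx))) t (concRadii2N (fcellsA κ Φ t p O.merged (gOf κ Φ t p O (KS.gT 0 gx)) (fOf κ Φ t p O (KS.fT 0 fx))) (Skelφ.Prm.gap ((SUA ex mx) κ Φ t p O.merged (gOf κ Φ t p O (KS.gT 0 gx)) (fOf κ Φ t p O (KS.fT 0 fx)) q)) (fun _ : ℕ => (0:ℕ)) (Skelφ.Prm.E₀ ((SUA ex mx) κ Φ t p O.merged (gOf κ Φ t p O (KS.gT 0 gx)) (fOf κ Φ t p O (KS.fT 0 fx)) q)) (Skelφ.Prm.Lp ((SUA ex mx) κ Φ t p O.merged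 (gOf κ Φ t p O (KS.gT 0 gx)) (fOf κ Φ t p O (KS.fT 0 fx)) q)) (offNA κ Φ t p O.merged (gOf κ Φ t p O (KS.gT 0 gx)) (fOf κ Φ t p O (KS.fT 0 fx)))) (b0TA κ Φ t p O.merged (gOf κ Φ t p O (KS.gT 0 gx)) (fOf κ Φ t p O (KS.fT 0 fx))) a' x du (Skelφ.Prm.Lp ((SUA ex mx) κ Φ t p O.merged (gOf κ Φ t p O (KS.gT 0 gx)) (fOf κ Φ t p O (KS.fT 0 fx)) q))) (O.merged.Λ c' (Mu O.merged)) (Skelφ.Prm.Lp (SUA ex mx κ Φ t p O.merged (gOf κ Φ t p O (KS.gT 0 gx)) (fOf κ Φ t p O (KS.fT 0 fx)) q)) ((fun i : Fin 2 => if i = 0 then KS.kF₀A κ Φ t p O.merged cF 0 (gOf κ Φ t p O (KS.gT 0 gx)) (fOf κ Φ t p O (KS.fT 0 fx)) else KS.kF₁A κ Φ t p O.merged cF 0 (gOf κ Φ t p O (KS.gT 0 gx)) (fOf κ Φ t p O (KS.fT 0 fx))) du.1) ((fun i : Fin 2 => if i = 0 then KS.kF₀A κ Φ t p O.merged cF 0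 (gOf κ Φ t p O (KS.gT 0 gx)) (fOf κ Φ t p O (KS.fT 0 fx)) else KS.kF₁A κ Φ t p O.merged cF 0 (gOf κ Φ t p O (KS.gT 0 gx)) (fOf κ Φ t p O (KS.fT 0 fx))) (oth du.1)), N.Nr = NrF x du j ((prFA κ Φ t p O.merged (gOf κ Φ t p O (KS.gT 0 gx)) (fOf κ Φ t p O (KS.fT 0 fx))).ψ (φL κ Φ t p O.D O.DT O.ori (gOf κ Φ t p O (KS.gT 0 gx)) (fOf κ Φ t p O (KS.fT 0 fx))) t c') ∧ N.N₃ = N3F x du j ((prFA κ Φ t p O.merged (gOf κ Φ t p O (KS.gT 0 gx)) (fOf κ Φ t p O (KS.fT 0 fx))).ψ (φL κ Φ t p O.D O.DT O.ori (gOf κ Φ t p O (KS.gT 0 gx)) (fOf κ Φ t p O (KS.fT 0 fx))) t c') := by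
    intro a' x du j pc c' hI hj yF hyF hpc hbox hball hM hE
    obtain ⟨hL1, hL2, hwc⟩ := Skelφ.cell_of_frame_box (φ := (φL κ Φ t p O.D O.DT O.ori (gOf κ Φ t p O (KS.gT 0 gx)) (fOf κ Φ t p O (KS.fT 0 fx)))) (prFA κ Φ t p O.merged (gOf κ Φ t p O (KS.gT 0 gx)) (fOf κ Φ t p O (KS.fT 0 fx))) t hc₀ hc₁ hD (fcellsA κ Φ t p O.merged (gOf κ Φ t p O (KS.gT 0 gx)) (fOf κ Φ t p O (KS.fT 0 fx))) (hnz du) hyF hpc (hroomB du) hbox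
    have FX := floorsX x du j ((prFA κ Φ t p O.merged (gOf κ Φ t p O (KS.gT 0 gx)) (fOf κ Φ t p O (KS.fT 0 fx))).ψ (φL κ Φ t p O.D O.DT O.ori (gOf κ Φ t p O (KS.gT 0 gx)) (fOf κ Φ t p O (KS.fT 0 fx))) t c') hI hj hL1 hL2 hwc
    exact Skelφ.numsX_of_floors₂E (steps_φL κ Φ t p O.D O.DT O.ori (gOf κ Φ t p O (KS.gT 0 gx)) (fOf κ Φ t p O (KS.fT 0 fx))) (prFA κ Φ t p O.merged (gOf κ Φ t p O (KS.gT 0 gx)) (fOf κ Φ t p O (KS.fT 0 fx))) t hn (one_le_nL_of_atQOS hAtS) (abs_vL_le_of_atQOS hAtS) hD hlipψ hws hA hκ₀ (abs_vL_le_of_atQOS hAtS) hc0 hc1 hmod hmod0 hDm (layer_of_atQOS hAtS) hmodlo hmodhi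
      (fcellsA κ Φ t p O.merged (gOf κ Φ t p O (KS.gT 0 gx)) (fOf κ Φ t p O (KS.fT 0 fx))) _ (b0TA κ Φ t p O.merged (gOf κ Φ t p O (KS.gT 0 gx)) (fOf κ Φ t p O (KS.fT 0 fx))) a' x du hI j hL' hM (by norm_num) c' hball hE (Mu O.merged) le_rfl (le_of_eq (by ring)) (le_of_eq (by ring)) (le_of_eq (by ring))
      FX.hfR (O.merged.Λ c' (Mu O.merged)) (hZk c' du) FX.hZfar ((fun σ' : ℤ => KS.BFd κ Φ t p O.merged cF 0 (gOf κ Φ t p O (KS.gT 0 gx)) (fOf κ Φ t p O (KS.fT 0 fx)) σ') (sgOf du)) (KS.RA' κ Φ t p O.merged 0) qB (KS.RA' κ Φ t p O.merged 0) qB₃ (yLF x du j ((prFA κ Φ t p O.merged (gOf κ Φ t p O (KS.gT 0 gx)) (fOf κ Φ t p O (KS.fT 0 fx))).ψ (φL κ Φ t p O.D O.DT O.ori (gOf κ Φ t p O (KS.gT 0 gx)) (fOf κ Φ t p O (KS.fT 0 fx))) t c')) (NrF x du j ((prFA κ Φ t p O.merged (gOf κ Φ t p O (KS.gT 0 gx))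 (fOf κ Φ t p O (KS.fT 0 fx))).ψ (φL κ Φ t p O.D O.DT O.ori (gOf κ Φ t p O (KS.gT 0 gx)) (fOf κ Φ t p O (KS.fT 0 fx))) t c')) (N3F x du j ((prFA κ Φ t p O.merged (gOf κ Φ t p O (KS.gT 0 gx)) (fOf κ Φ t p O (KS.fT 0 fx))).ψ (φL κ Φ t p O.D O.DT O.ori (gOf κ Φ t p O (KS.gT 0 gx)) (fOf κ Φ t p O (KS.fT 0 fx))) t c'))
      FX.hσT FX.FX1 FX.FX2 FX.FX3 FX.FX4 FX.FX5 FX.FX6 FX.FY1 FX.FY2 FX.FY3 FX.FY4 FX.FY5 FX.FY6 FX.FL1 FX.FL2 FX.FL3 FX.FL4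
      FX.hfit FX.hq₃ FX.hxaX FX.hxbX FX.hclr FX.hclr₃ FX.hπ2X FX.hπ3X
  -- the y′-face numbers with their counts exposed
  have HY : ∀ (a' : ℕ) (x : Site 2) (du : MDir) (j : ℕ) (pc : ℤ) (c' : V), du.1 = 1 → j < (fcellsA κ Φ t p O.merged (gOf κ Φ t p O (KS.gT 0 gx)) (fOf κ Φ t p O (KS.fT 0 fx))).K → ∀ yF : V,
      (prFA κ Φ t p O.merged (gOf κ Φ t p O (KS.gT 0 gx)) (fOf κ Φ t p O (KS.fT 0 fx))).ψ (φL κ Φ t p O.D O.DT O.ori (gOf κ Φ t p O (KS.gT 0 gx)) (fOf κ Φ t p O (KS.fT 0 fx))) t yF = (fcellsA κ Φ t p O.merged (gOf κ Φ t p O (KS.gT 0 gx)) (fOf κ Φ t p O (KS.fT 0 fx))).faceCen x du j → pc = relφ (φL κ Φ t p O.D O.DT O.ori (gOf κ Φ t p O (KS.gT 0 gx)) (fOf κ Φ t p O (KS.fT 0 fx))) t yF ((prFA κ Φ t p O.merged (gOf κ Φ t p O (KS.gT 0 gx)) (fOf κ Φ t p O (KS.fT 0 fx))).bOf du.1) 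→
      (prFA κ Φ t p O.merged (gOf κ Φ t p O (KS.gT 0 gx)) (fOf κ Φ t p O (KS.fT 0 fx))).frame (φL κ Φ t p O.D O.DT O.ori (gOf κ Φ t p O (KS.gT 0 gx)) (fOf κ Φ t p O (KS.fT 0 fx))) t du.1 ((prFA κ Φ t p O.merged (gOf κ Φ t p O (KS.gT 0 gx)) (fOf κ Φ t p O (KS.fT 0 fx))).bOf du.1) c' ∈ Finset.Icc (loN (fcellsA κ Φ t p O.merged (gOf κ Φ t p O (KS.gT 0 gx)) (fOf κ Φ t p O (KS.fT 0 fx))) x du j pc ((fun du : MDir => ((prFA κ Φ t p O.merged (gOf κ Φ t p O (KS.gT 0 gx)) (fOf κ Φ t p O (KS.fT 0 fx))).awF₂ (fcellsA κ Φ t p O.merged (gOf κ Φ t p O (KS.gT 0 gx)) (fOf κ Φ t p O (KS.fT 0 fx))) du).toNat) du) - (((KS.RlevA κ Φ t p O.merged 0 + KS.reachA t O.merged 0) : ℕ) : Site 2)) (hiN (fcellsA κ Φ t p O.merged (gOf κ Φ t p O (KS.gT 0 gx)) (fOf κ Φ t p O (KS.fT 0 fx))) x du j pc ((fun du : MDir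 => ((prFA κ Φ t p O.merged (gOf κ Φ t p O (KS.gT 0 gx)) (fOf κ Φ t p O (KS.fT 0 fx))).awF₂ (fcellsA κ Φ t p O.merged (gOf κ Φ t p O (KS.gT 0 gx)) (fOf κ Φ t p O (KS.fT 0 fx))) du).toNat) du) + (((KS.RlevA κ Φ t p O.merged 0 + KS.reachA t O.merged 0) : ℕ) : Site 2)) →
      c' ∈ graphBall G t ((concRadii2N (fcellsA κ Φ t p O.merged (gOf κ Φ t p O (KS.gT 0 gx)) (fOf κ Φ t p O (KS.fT 0 fx))) (Skelφ.Prm.gap ((SUA ex mx) κ Φ t p O.merged (gOf κ Φ t p O (KS.gT 0 gx)) (fOf κ Φ t p O (KS.fT 0 fx)) q)) (fun _ : ℕ => (0:ℕ)) (Skelφ.Prm.E₀ ((SUA ex mx) κ Φ t p O.merged (gOf κ Φ t p O (KS.gT 0 gx)) (fOf κ Φ t p O (KS.fT 0 fx)) q)) (Skelφ.Prm.Lp ((SUA ex mx) κ Φ t p O.merged (gOf κ Φ t p O (KS.gT 0 gx)) (fOf κ Φ t p O (KS.fT 0 fx)) q)) (offNA κ Φ t p O.merged (gOf κ Φ t p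 O (KS.gT 0 gx)) (fOf κ Φ t p O (KS.fT 0 fx)))).rE a' x du - (Skelφ.Prm.Lp (SUA ex mx κ Φ t p O.merged (gOf κ Φ t p O (KS.gT 0 gx)) (fOf κ Φ t p O (KS.fT 0 fx)) q))) →
      (Skelφ.Prm.Lp ((SUA ex mx) κ Φ t p O.merged (gOf κ Φ t p O (KS.gT 0 gx)) (fOf κ Φ t p O (KS.fT 0 fx)) q)) ≤ (concRadii2N (fcellsA κ Φ t p O.merged (gOf κ Φ t p O (KS.gT 0 gx)) (fOf κ Φ t p O (KS.fT 0 fx))) (Skelφ.Prm.gap ((SUA ex mx) κ Φ t p O.merged (gOf κ Φ t p O (KS.gT 0 gx)) (fOf κ Φ t p O (KS.fT 0 fx)) q)) (fun _ : ℕ => (0:ℕ)) (Skelφ.Prm.E₀ ((SUA ex mx) κ Φ t p O.merged (gOf κ Φ t p O (KS.gT 0 gx)) (fOf κ Φ t p O (KS.fT 0 fx)) q)) (Skelφ.Prm.Lp ((SUA ex mx) κ Φ t p O.merged (gOf κ Φ t p O (KS.gT 0 gx)) (fOf κ Φ t p O (KS.fT 0 fx)) q)) (offNA κ Φ t p O.merged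 (gOf κ Φ t p O (KS.gT 0 gx)) (fOf κ Φ t p O (KS.fT 0 fx)))).rM a' (x + stepVec du) → (Skelφ.Prm.Lp (SUA ex mx κ Φ t p O.merged (gOf κ Φ t p O (KS.gT 0 gx)) (fOf κ Φ t p O (KS.fT 0 fx)) q)) ≤ (concRadii2N (fcellsA κ Φ t p O.merged (gOf κ Φ t p O (KS.gT 0 gx)) (fOf κ Φ t p O (KS.fT 0 fx))) (Skelφ.Prm.gap ((SUA ex mx) κ Φ t p O.merged (gOf κ Φ t p O (KS.gT 0 gx)) (fOf κ Φ t p O (KS.fT 0 fx)) q)) (fun _ : ℕ => (0:ℕ)) (Skelφ.Prm.E₀ ((SUA ex mx) κ Φ t p O.merged (gOf κ Φ t p O (KS.gT 0 gx)) (fOf κ Φ t p O (KS.fT 0 fx)) q)) (Skelφ.Prm.Lp ((SUA ex mx) κ Φ t p O.merged (gOf κ Φ t p O (KS.gT 0 gx)) (fOf κ Φ t p O (KS.fT 0 fx)) q)) (offNA κ Φ t p O.merged (gOf κ Φ t p O (KS.gT 0 gx)) (fOf κ Φ t p O (KS.fT 0 fx)))).rE a' x du →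
      ∃ N : FaceRunNumsY4 G (φL κ Φ t p O.D O.DT O.ori (gOf κ Φ t p O (KS.gT 0 gx)) (fOf κ Φ t p O (KS.fT 0 fx))) ((prFA κ Φ t p O.merged (gOf κ Φ t p O (KS.gT 0 gx)) (fOf κ Φ t p O (KS.fT 0 fx))).ψ (φL κ Φ t p O.D O.DT O.ori (gOf κ Φ t p O (KS.gT 0 gx)) (fOf κ Φ t p O (KS.fT 0 fx))) t) c' (prFA κ Φ t p O.merged (gOf κ Φ t p O (KS.gT 0 gx)) (fOf κ Φ t p O (KS.fT 0 fx))).A (nL κ Φ t p O.merged (gOf κ Φ t p O (KS.gT 0 gx)) (fOf κ Φ t p O (KS.fT 0 fx))) (prFA κ Φ t p O.merged (gOf κ Φ t p O (KS.gT 0 gx)) (fOf κ Φ t p O (KS.fT 0 fx))).h (prFA κ Φ t p O.merged (gOf κ Φ t p O (KS.gT 0 gx)) (fOf κ Φ t p O (KS.fT 0 fx))).vα (prFA κ Φ t p O.merged (gOf κ Φ t p O (KS.gT 0 gx)) (fOf κ Φ t p O (KS.fT 0 fx))).vβ (prFA κ Φ t p O.merged (gOf κ Φ t p O (KS.gT 0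 gx)) (fOf κ Φ t p O (KS.fT 0 fx))).c₀ (prFA κ Φ t p O.merged (gOf κ Φ t p O (KS.gT 0 gx)) (fOf κ Φ t p O (KS.fT 0 fx))).c₁ (prFA κ Φ t p O.merged (gOf κ Φ t p O (KS.gT 0 gx)) (fOf κ Φ t p O (KS.fT 0 fx))).D du (σhF du) (sgOf du) ((fun σ' : ℤ => KS.BFd κ Φ t p O.merged cF 0 (gOf κ Φ t p O (KS.gT 0 gx)) (fOf κ Φ t p O (KS.fT 0 fx)) σ') (σhF du)) (ℓL κ Φ t p O.merged (gOf κ Φ t p O (KS.gT 0 gx)) (fOf κ Φ t p O (KS.fT 0 fx))) (KS.RA' κ Φ t p O.merged 0) qB' (KS.RA' κ Φ t p O.merged 0) qB₃' (prFA κ Φ t p O.merged (gOf κ Φ t p O (KS.gT 0 gx)) (fOf κ Φ t p O (KS.fT 0 fx))).vα (one_le_nL_of_atQOS (atQOS_of_atQOTA hAt)) (abs_vL_le_of_atQOS (atQOS_of_atQOTA hAt))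
        (layer_of_atQOS (atQOS_of_atQOTA hAt)) (Mu O.merged) ((fcellsA κ Φ t p O.merged (gOf κ Φ t p O (KS.gT 0 gx)) (fOf κ Φ t p O (KS.fT 0 fx))).farCore x du j (3 : ℤ)) (targetMM G (φL κ Φ t p O.D O.DT O.ori (gOf κ Φ t p O (KS.gT 0 gx)) (fOf κ Φ t p O (KS.fT 0 fx))) (prFA κ Φ t p O.merged (gOf κ Φ t p O (KS.gT 0 gx)) (fOf κ Φ t p O (KS.fT 0 fx))) (fcellsA κ Φ t p O.merged (gOf κ Φ t p O (KS.gT 0 gx)) (fOf κ Φ t p O (KS.fT 0 fx))) t (concRadii2N (fcellsA κ Φ t p O.merged (gOf κ Φ t p O (KS.gT 0 gx)) (fOf κ Φ t p O (KS.fT 0 fx))) (Skelφ.Prm.gap ((SUA ex mx) κ Φ t p O.merged (gOf κ Φ t p O (KS.gT 0 gx)) (fOf κ Φ t p O (KS.fT 0 fx)) q)) (fun _ : ℕ => (0:ℕ)) (Skelφ.Prm.E₀ ((SUA ex mx) κ Φ t p O.merged (gOf κ Φ t p O (KS.gT 0 gx)) (fOf κ Φ t p O (KS.fT 0 fx)) q))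 (Skelφ.Prm.Lp ((SUA ex mx) κ Φ t p O.merged (gOf κ Φ t p O (KS.gT 0 gx)) (fOf κ Φ t p O (KS.fT 0 fx)) q)) (offNA κ Φ t p O.merged (gOf κ Φ t p O (KS.gT 0 gx)) (fOf κ Φ t p O (KS.fT 0 fx)))) (b0TA κ Φ t p O.merged (gOf κ Φ t p O (KS.gT 0 gx)) (fOf κ Φ t p O (KS.fT 0 fx))) a' x du (Skelφ.Prm.Lp ((SUA ex mx) κ Φ t p O.merged (gOf κ Φ t p O (KS.gT 0 gx)) (fOf κ Φ t p O (KS.fT 0 fx)) q))) (O.merged.Λ c' (Mu O.merged)) (Skelφ.Prm.Lp (SUA ex mx κ Φ t p O.merged (gOf κ Φ t p O (KS.gT 0 gx)) (fOf κ Φ t p O (KS.fT 0 fx)) q)) ((fun i : Fin 2 => if i = 0 then KS.kF₀A κ Φ t p O.merged cF 0 (gOf κ Φ t p O (KS.gT 0 gx)) (fOf κ Φ t p O (KS.fT 0 fx)) else KS.kF₁A κ Φ t p O.merged cF 0 (gOf κ Φ t p O (KS.gT 0 gx)) (fOf κ Φ t p O (KS.fT 0 fx))) du.1) ((fun i : Fin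 2 => if i = 0 then KS.kF₀A κ Φ t p O.merged cF 0 (gOf κ Φ t p O (KS.gT 0 gx)) (fOf κ Φ t p O (KS.fT 0 fx)) else KS.kF₁A κ Φ t p O.merged cF 0 (gOf κ Φ t p O (KS.gT 0 gx)) (fOf κ Φ t p O (KS.fT 0 fx))) (oth du.1)), N.Nr = NrF' x du j ((prFA κ Φ t p O.merged (gOf κ Φ t p O (KS.gT 0 gx)) (fOf κ Φ t p O (KS.fT 0 fx))).ψ (φL κ Φ t p O.D O.DT O.ori (gOf κ Φ t p O (KS.gT 0 gx)) (fOf κ Φ t p O (KS.fT 0 fx))) t c') ∧ N.N₃ = N3F' x du j ((prFA κ Φ t p O.merged (gOf κ Φ t p O (KS.gT 0 gx)) (fOf κ Φ t p O (KS.fT 0 fx))).ψ (φL κ Φ t p O.D O.DT O.ori (gOf κ Φ t p O (KS.gT 0 gx)) (fOf κ Φ t p O (KS.fT 0 fx))) t c') := by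
    intro a' x du j pc c' hI hj yF hyF hpc hbox hball hM hE
    obtain ⟨hL1, hL2, hwc⟩ := Skelφ.cell_of_frame_box (φ := (φL κ Φ t p O.D O.DT O.ori (gOf κ Φ t p O (KS.gT 0 gx)) (fOf κ Φ t p O (KS.fT 0 fx)))) (prFA κ Φ t p O.merged (gOf κ Φ t p O (KS.gT 0 gx)) (fOf κ Φ t p O (KS.fT 0 fx))) t hc₀ hc₁ hD (fcellsA κ Φ t p O.merged (gOf κ Φ t p O (KS.gT 0 gx)) (fOf κ Φ t p O (KS.fT 0 fx))) (hnz du) hyF hpc (hroomB du) hbox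
    have FY := floorsY x du j ((prFA κ Φ t p O.merged (gOf κ Φ t p O (KS.gT 0 gx)) (fOf κ Φ t p O (KS.fT 0 fx))).ψ (φL κ Φ t p O.D O.DT O.ori (gOf κ Φ t p O (KS.gT 0 gx)) (fOf κ Φ t p O (KS.fT 0 fx))) t c') hI hj hL1 hL2 hwc
    exact Skelφ.numsY_of_floors₂E (steps_φL κ Φ t p O.D O.DT O.ori (gOf κ Φ t p O (KS.gT 0 gx)) (fOf κ Φ t p O (KS.fT 0 fx))) (prFA κ Φ t p O.merged (gOf κ Φ t p O (KS.gT 0 gx)) (fOf κ Φ t p O (KS.fT 0 fx))) t hn (one_le_nL_of_atQOS hAtS) (abs_vL_le_of_atQOS hAtS) hD hlipψ hws hA hκ₀ (abs_vL_le_of_atQOS hAtS) hc0 hc1 hmod hmod0 hDm (layer_of_atQOS hAtS) hmodlo hmodhi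
      (fcellsA κ Φ t p O.merged (gOf κ Φ t p O (KS.gT 0 gx)) (fOf κ Φ t p O (KS.fT 0 fx))) _ (b0TA κ Φ t p O.merged (gOf κ Φ t p O (KS.gT 0 gx)) (fOf κ Φ t p O (KS.fT 0 fx))) a' x du hI j hL' hM (by norm_num) c' hball hE (Mu O.merged) le_rfl (le_of_eq (by ring)) (le_of_eq (by ring)) (le_of_eq (by ring))
      FY.hfR (O.merged.Λ c' (Mu O.merged)) (hZk c' du) FY.hZfar FY.hσh ((fun σ' : ℤ => KS.BFd κ Φ t p O.merged cF 0 (gOf κ Φ t p O (KS.gT 0 gx)) (fOf κ Φ t p O (KS.fT 0 fx)) σ') (σhF du)) (KS.RA' κ Φ t p O.merged 0) qB' (KS.RA' κ Φ t p O.merged 0) qB₃' (yLF' x du j ((prFA κ Φ t p O.merged (gOf κ Φ t p O (KS.gT 0 gx)) (fOf κ Φ t p O (KS.fT 0 fx))).ψ (φL κ Φ t p O.D O.DT O.ori (gOf κ Φ t p O (KS.gT 0 gx)) (fOf κ Φ t p O (KS.fT 0 fx))) t c')) (NrF' x du j ((prFA κ Φ t p O.merged (gOf κ Φ t p O (KS.gT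 0 gx)) (fOf κ Φ t p O (KS.fT 0 fx))).ψ (φL κ Φ t p O.D O.DT O.ori (gOf κ Φ t p O (KS.gT 0 gx)) (fOf κ Φ t p O (KS.fT 0 fx))) t c')) (N3F' x du j ((prFA κ Φ t p O.merged (gOf κ Φ t p O (KS.gT 0 gx)) (fOf κ Φ t p O (KS.fT 0 fx))).ψ (φL κ Φ t p O.D O.DT O.ori (gOf κ Φ t p O (KS.gT 0 gx)) (fOf κ Φ t p O (KS.fT 0 fx))) t c'))
      FY.hσT FY.FA1 FY.FA2 FY.FA3 FY.FA4 FY.FA5 FY.FA6 FY.FT1 FY.FT2 FY.FT3 FY.FT4 FY.FT5 FY.FT6 FY.FL1 FY.FL2 FY.FL3 FY.FL4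
      FY.hq₃ FY.hW FY.hxaY FY.hxbY FY.hclrLo FY.hclrHi FY.hclr₃ FY.hπ2Y FY.hπ3Y
  have HNX : ∀ a' x du j pc c' hI hj yF hyF hpc hbox hball hM hE, 0 + 1 + (Classical.choose (HX a' x du j pc c' hI hj yF hyF hpc hbox hball hM hE)).Nr + 1 + (Classical.choose (HX a' x du j pc c' hI hj yF hyF hpc hbox hball hM hE)).N₃ ≤ NegB.nFA κ.K₀ :=
    fun a' x du j pc c' hI hj yF hyF hpc hbox hball hM hE => by
    obtain ⟨e1, e2⟩ := Classical.choose_spec (HX a' x du j pc c' hI hj yF hyF hpc hbox hball hM hE)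
    rw [e1, e2]; have hc := hcapX x du j ((prFA κ Φ t p O.merged (gOf κ Φ t p O (KS.gT 0 gx)) (fOf κ Φ t p O (KS.fT 0 fx))).ψ (φL κ Φ t p O.D O.DT O.ori (gOf κ Φ t p O (KS.gT 0 gx)) (fOf κ Φ t p O (KS.fT 0 fx))) t c'); omega
  have HNY : ∀ a' x du j pc c' hI hj yF hyF hpc hbox hball hM hE, 0 + 1 + (Classical.choose (HY a' x du j pc c' hI hj yF hyF hpc hbox hball hM hE)).Nr + 1 + (Classical.choose (HY a' x du j pc c' hI hj yF hyF hpc hbox hball hM hE)).N₃ ≤ NegB.nFA κ.K₀ :=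
    fun a' x du j pc c' hI hj yF hyF hpc hbox hball hM hE => by
    obtain ⟨e1, e2⟩ := Classical.choose_spec (HY a' x du j pc c' hI hj yF hyF hpc hbox hball hM hE)
    rw [e1, e2]; have hc := hcapY x du j ((prFA κ Φ t p O.merged (gOf κ Φ t p O (KS.gT 0 gx)) (fOf κ Φ t p O (KS.fT 0 fx))).ψ (φL κ Φ t p O.D O.DT O.ori (gOf κ Φ t p O (KS.gT 0 gx)) (fOf κ Φ t p O (KS.fT 0 fx))) t c'); omega
  exact faceOblRM_negBTC₃d cF gx fx Px ex mx hAt hmx hex hSF16 hPx htr h1 hp0 hp1 σhF hσhF qB qB₃ qB' qB₃' hCF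
    (fun a' x du j pc c' hI hj yF hyF hpc hbox hball hM hE => Classical.choose (HX a' x du j pc c' hI hj yF hyF hpc hbox hball hM hE)) (fun a' x du j pc c' hI hj yF hyF hpc hbox hball hM hE => Classical.choose (HY a' x du j pc c' hI hj yF hyF hpc hbox hball hM hE)) HNX HNY

set_option maxHeartbeats 1600000 in
/-- **The provider layer B4 of the (F) wrapper, case `o_F ≠ o_L`, bridge = top piece of `trφ φL`**: the per-centre numbers and their caps from the linear floors (see the module docstring).
[cite: KozmaNitzan2024, §4 Lemma 12 (pp. 23–25)] -/
theorem faceOblRM_negBTC₄t (cF : ℕ) (gx fx : Neg.FSlot) (Px : PSlot) (ex mx : GSlot)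
    (hAt : (choiceAtOTA κ Φ t p (KS.gT 0 gx) (KS.fT 0 fx) (SUA ex mx) hC (KS.PR 0 Px)).AtQO O q)
    (hmx : (prFA κ Φ t p O.merged (gOf κ Φ t p O (KS.gT 0 gx)) (fOf κ Φ t p O (KS.fT 0 fx))).mF (fcellsA κ Φ t p O.merged (gOf κ Φ t p O (KS.gT 0 gx)) (fOf κ Φ t p O (KS.fT 0 fx))) ≤ ((mx κ Φ t p O.merged (gOf κ Φ t p O (KS.gT 0 gx)) (fOf κ Φ t p O (KS.fT 0 fx)) : ℕ) : ℤ))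
    (hex : exA κ Φ t p O.merged (gOf κ Φ t p O (KS.gT 0 gx)) (fOf κ Φ t p O (KS.fT 0 fx)) ≤ ex κ Φ t p O.merged (gOf κ Φ t p O (KS.gT 0 gx)) (fOf κ Φ t p O (KS.fT 0 fx)) ∧
      KS.r₀A Φ t O.merged 0 (O.merged.R (O.merged.scale t (KS.MBF κ Φ t p O.merged cF 0) (KS.nBF κ Φ t p O.merged cF 0))) + 1 ≤ ex κ Φ t p O.merged (gOf κ Φ t p O (KS.gT 0 gx)) (fOf κ Φ t p O (KS.fT 0 fx)))
    (hSF16 : 16 * KS.SF κ Φ t p O.merged cF 0 ≤ ML κ Φ t p O.merged (gOf κ Φ t p O (KS.gT 0 gx)))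
    (hPx : (KS.MBF κ Φ t p O.merged cF 0, KS.nBF κ Φ t p O.merged cF 0) ∈ (KS.PR 0 Px κ Φ t p O.merged).1)
    (htr : oriφ Φ.φ (O.ori t (KS.MBF κ Φ t p O.merged cF 0) (KS.nBF κ Φ t p O.merged cF 0)) = trφ (φL κ Φ t p O.D O.DT O.ori (gOf κ Φ t p O (KS.gT 0 gx)) (fOf κ Φ t p O (KS.fT 0 fx))))(h1 : Φ.types = {t}) (hp0 : 0 < (p : ℝ)) (hp1 : (p : ℝ) < 1)
      (σhF : MDir → ℤ) (hσhF : ∀ du : MDir, σhF du = 1 ∨ σhF du = -1)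
     (qB qB₃ qB' qB₃' : ℕ)
       (hCF : ChainFactL NegB.LfA G Φ.Δ κ)
    -- the x-face / y′-face choice functions (landing origin, along count, tangential count, tangential sign), per contact cell
    (yLF : Site 2 → MDir → ℕ → Site 2 → Site 2) (NrF N3F : Site 2 → MDir → ℕ → Site 2 → ℕ) (σTF : Site 2 → MDir → ℕ → Site 2 → ℤ)
    (yLF' : Site 2 → MDir → ℕ → Site 2 → Site 2) (NrF' N3F' : Site 2 → MDir → ℕ → Site 2 → ℕ) (σTF' : Site 2 → MDir → ℕ → Site 2 → ℤ)
    -- THE LINEAR FLOORS at every admissible contact cell (M3), band `E := RlevA + reachA`, transverse offset `kE := kFF₂ (E − 1) du.1`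
    (floorsX : ∀ (x : Site 2) (du : MDir) (j : ℕ) (z : Site 2), du.1 = 0 → j < (fcellsA κ Φ t p O.merged (gOf κ Φ t p O (KS.gT 0 gx)) (fOf κ Φ t p O (KS.fT 0 fx))).K → ((fcellsA κ Φ t p O.merged (gOf κ Φ t p O (KS.gT 0 gx)) (fOf κ Φ t p O (KS.fT 0 fx))).faceL du.1 j : ℤ) - (((KS.RlevA κ Φ t p O.merged 0 + KS.reachA t O.merged 0) : ℕ) : ℤ) ≤ (fcellsA κ Φ t p O.merged (gOf κ Φ t p O (KS.gT 0 gx)) (fOf κ Φ t p O (KS.fT 0 fx))).lev du x z →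
      (fcellsA κ Φ t p O.merged (gOf κ Φ t p O (KS.gT 0 gx)) (fOf κ Φ t p O (KS.fT 0 fx))).lev du x z ≤ (fcellsA κ Φ t p O.merged (gOf κ Φ t p O (KS.gT 0 gx)) (fOf κ Φ t p O (KS.fT 0 fx))).faceL du.1 j + (((KS.RlevA κ Φ t p O.merged 0 + KS.reachA t O.merged 0) : ℕ) : ℤ) → |z (oth du.1) - (fcellsA κ Φ t p O.merged (gOf κ Φ t p O (KS.gT 0 gx)) (fOf κ Φ t p O (KS.fT 0 fx))).cen x (oth du.1)| ≤ ((prFA κ Φ t p O.merged (gOf κ Φ t p O (KS.gT 0 gx)) (fOf κ Φ t p O (KS.fT 0 fx))).kFF₂ (fcellsA κ Φ t p O.merged (gOf κ Φ t p O (KS.gT 0 gx)) (fOf κ Φ t p O (KS.fT 0 fx))) ((KS.RlevA κ Φ t p O.merged 0 + KS.reachA t O.merged 0) - 1) du.1) →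
      Skelφ.FloorsX2 (prFA κ Φ t p O.merged (gOf κ Φ t p O (KS.gT 0 gx)) (fOf κ Φ t p O (KS.fT 0 fx))) (nL κ Φ t p O.merged (gOf κ Φ t p O (KS.gT 0 gx)) (fOf κ Φ t p O (KS.fT 0 fx))) (((fcellsA κ Φ t p O.merged (gOf κ Φ t p O (KS.gT 0 gx)) (fOf κ Φ t p O (KS.fT 0 fx))).s 0 : ℕ) : ℤ) (((fcellsA κ Φ t p O.merged (gOf κ Φ t p O (KS.gT 0 gx)) (fOf κ Φ t p O (KS.fT 0 fx))).s 1 : ℕ) : ℤ) (modulus (nL κ Φ t p O.merged (gOf κ Φ t p O (KS.gT 0 gx)) (fOf κ Φ t p O (KS.fT 0 fx))) (hL κ Φ t p O.merged (gOf κ Φ t p O (KS.gT 0 gx)) (fOf κ Φ t p O (KS.fT 0 fx))) (vL κ Φ t p O.merged (gOf κ Φ t p O (KS.gT 0 gx)) (fOf κ Φ t p O (KS.fT 0 fx))) (vβL κ Φ t p O.merged (gOf κ Φ t p O (KS.gT 0 gx)) (fOf κ Φ t p O (KS.fT 0 fx)))) (((nL κ Φ t p O.merged (gOf κ Φ t p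 O (KS.gT 0 gx)) (fOf κ Φ t p O (KS.fT 0 fx))) : ℕ) : ℤ) (ℓL κ Φ t p O.merged (gOf κ Φ t p O (KS.gT 0 gx)) (fOf κ Φ t p O (KS.fT 0 fx))) (fcellsA κ Φ t p O.merged (gOf κ Φ t p O (KS.gT 0 gx)) (fOf κ Φ t p O (KS.fT 0 fx))) (b0TA κ Φ t p O.merged (gOf κ Φ t p O (KS.gT 0 gx)) (fOf κ Φ t p O (KS.fT 0 fx))) x du j (3 : ℤ) (Skelφ.Prm.Lp (SUA ex mx κ Φ t p O.merged (gOf κ Φ t p O (KS.gT 0 gx)) (fOf κ Φ t p O (KS.fT 0 fx)) q)) (Mu O.merged) z (fun i : Fin 2 => if i = 0 then KS.kF₀A κ Φ t p O.merged cF 0 (gOf κ Φ t p O (KS.gT 0 gx)) (fOf κ Φ t p O (KS.fT 0 fx)) else KS.kF₁A κ Φ t p O.merged cF 0 (gOf κ Φ t p O (KS.gT 0 gx)) (fOf κ Φ t p O (KS.fT 0 fx))) ((fun σ' : ℤ => KS.BFt κ Φ t p O.merged cF 0 (gOf κ Φ t p O (KS.gT 0 gx)) (fOf κ Φ t p O (KS.fT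 0 fx)) σ') (sgOf du)) (KS.RA' κ Φ t p O.merged 0) qB (KS.RA' κ Φ t p O.merged 0) qB₃ (yLF x du j z) (NrF x du j z) (N3F x du j z) (σTF x du j z))
    (floorsY : ∀ (x : Site 2) (du : MDir) (j : ℕ) (z : Site 2), du.1 = 1 → j < (fcellsA κ Φ t p O.merged (gOf κ Φ t p O (KS.gT 0 gx)) (fOf κ Φ t p O (KS.fT 0 fx))).K → ((fcellsA κ Φ t p O.merged (gOf κ Φ t p O (KS.gT 0 gx)) (fOf κ Φ t p O (KS.fT 0 fx))).faceL du.1 j : ℤ) - (((KS.RlevA κ Φ t p O.merged 0 + KS.reachA t O.merged 0) : ℕ) : ℤ) ≤ (fcellsA κ Φ t p O.merged (gOf κ Φ t p O (KS.gT 0 gx)) (fOf κ Φ t p O (KS.fT 0 fx))).lev du x z →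
      (fcellsA κ Φ t p O.merged (gOf κ Φ t p O (KS.gT 0 gx)) (fOf κ Φ t p O (KS.fT 0 fx))).lev du x z ≤ (fcellsA κ Φ t p O.merged (gOf κ Φ t p O (KS.gT 0 gx)) (fOf κ Φ t p O (KS.fT 0 fx))).faceL du.1 j + (((KS.RlevA κ Φ t p O.merged 0 + KS.reachA t O.merged 0) : ℕ) : ℤ) → |z (oth du.1) - (fcellsA κ Φ t p O.merged (gOf κ Φ t p O (KS.gT 0 gx)) (fOf κ Φ t p O (KS.fT 0 fx))).cen x (oth du.1)| ≤ ((prFA κ Φ t p O.merged (gOf κ Φ t p O (KS.gT 0 gx)) (fOf κ Φ t p O (KS.fT 0 fx))).kFF₂ (fcellsA κ Φ t p O.merged (gOf κ Φ t p O (KS.gT 0 gx)) (fOf κ Φ t p O (KS.fT 0 fx))) ((KS.RlevA κ Φ t p O.merged 0 + KS.reachA t O.merged 0) - 1) du.1) →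
      Skelφ.FloorsY2 (prFA κ Φ t p O.merged (gOf κ Φ t p O (KS.gT 0 gx)) (fOf κ Φ t p O (KS.fT 0 fx))) (nL κ Φ t p O.merged (gOf κ Φ t p O (KS.gT 0 gx)) (fOf κ Φ t p O (KS.fT 0 fx))) (((fcellsA κ Φ t p O.merged (gOf κ Φ t p O (KS.gT 0 gx)) (fOf κ Φ t p O (KS.fT 0 fx))).s 0 : ℕ) : ℤ) (((fcellsA κ Φ t p O.merged (gOf κ Φ t p O (KS.gT 0 gx)) (fOf κ Φ t p O (KS.fT 0 fx))).s 1 : ℕ) : ℤ) (modulus (nL κ Φ t p O.merged (gOf κ Φ t p O (KS.gT 0 gx)) (fOf κ Φ t p O (KS.fT 0 fx))) (hL κ Φ t p O.merged (gOf κ Φ t p O (KS.gT 0 gx)) (fOf κ Φ t p O (KS.fT 0 fx))) (vL κ Φ t p O.merged (gOf κ Φ t p O (KS.gT 0 gx)) (fOf κ Φ t p O (KS.fT 0 fx))) (vβL κ Φ t p O.merged (gOf κ Φ t p O (KS.gT 0 gx)) (fOf κ Φ t p O (KS.fT 0 fx)))) (((nL κ Φ t p O.merged (gOf κ Φ t p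 O (KS.gT 0 gx)) (fOf κ Φ t p O (KS.fT 0 fx))) : ℕ) : ℤ) (ℓL κ Φ t p O.merged (gOf κ Φ t p O (KS.gT 0 gx)) (fOf κ Φ t p O (KS.fT 0 fx))) (fcellsA κ Φ t p O.merged (gOf κ Φ t p O (KS.gT 0 gx)) (fOf κ Φ t p O (KS.fT 0 fx))) (b0TA κ Φ t p O.merged (gOf κ Φ t p O (KS.gT 0 gx)) (fOf κ Φ t p O (KS.fT 0 fx))) x du j (3 : ℤ) (Skelφ.Prm.Lp (SUA ex mx κ Φ t p O.merged (gOf κ Φ t p O (KS.gT 0 gx)) (fOf κ Φ t p O (KS.fT 0 fx)) q)) (Mu O.merged) z (fun i : Fin 2 => if i = 0 then KS.kF₀A κ Φ t p O.merged cF 0 (gOf κ Φ t p O (KS.gT 0 gx)) (fOf κ Φ t p O (KS.fT 0 fx)) else KS.kF₁A κ Φ t p O.merged cF 0 (gOf κ Φ t p O (KS.gT 0 gx)) (fOf κ Φ t p O (KS.fT 0 fx))) (σhF du) ((fun σ' : ℤ => KS.BFt κ Φ t p O.merged cF 0 (gOf κ Φ t p O (KS.gT 0 gx)) (fOf κ Φ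 t p O (KS.fT 0 fx)) σ') (σhF du)) (KS.RA' κ Φ t p O.merged 0) qB' (KS.RA' κ Φ t p O.merged 0) qB₃' (yLF' x du j z) (NrF' x du j z) (N3F' x du j z) (σTF' x du j z))
    -- the stride counts within the chain budget
    (hcapX : ∀ (x : Site 2) (du : MDir) (j : ℕ) (z : Site 2), NrF x du j z + N3F x du j z + 2 ≤ NegB.nFA κ.K₀)
    (hcapY : ∀ (x : Site 2) (du : MDir) (j : ℕ) (z : Site 2), NrF' x du j z + N3F' x du j z + 2 ≤ NegB.nFA κ.K₀) :
    Skelφ.FaceOblRM G ((choiceAtOTA κ Φ t p (KS.gT 0 gx) (KS.fT 0 fx) (SUA ex mx) hC (KS.PR 0 Px)).scheme O q)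
      ((choiceAtOTA κ Φ t p (KS.gT 0 gx) (KS.fT 0 fx) (SUA ex mx) hC (KS.PR 0 Px)).FD O q) Φ.Δ κ.δ₂ := by
  -- facts at `AtQO`
  have hAtS := atQOS_of_atQOTA hAt
  have hNL : EqNumL κ Φ t p O.merged (gOf κ Φ t p O (KS.gT 0 gx)) (fOf κ Φ t p O (KS.fT 0 fx)) := eqNumL_of_atQOTA hAt
  obtain ⟨hnL1, hℓL1⟩ := one_le_of_eqNumL κ Φ t p O.merged (gOf κ Φ t p O (KS.gT 0 gx)) (fOf κ Φ t p O (KS.fT 0 fx)) hNL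
  obtain ⟨hF, -, -, -⟩ := factsO_of_atQOTA hAt
  obtain ⟨-, -, -, -, hΛeq⟩ := hF.seed
  have hZ : ∀ c, (↑(O.merged.Λ c (Mu O.merged)) : Set V) ⊆ Skelφ.cyl (φL κ Φ t p O.D O.DT O.ori (gOf κ Φ t p O (KS.gT 0 gx)) (fOf κ Φ t p O (KS.fT 0 fx))) c (Mu O.merged) := fun c => by
    unfold NegB.φL; rw [Skelφ.cyl_oriφ, hΛeq]; exact Skelφ.fatSeq_subset_cyl Φ.frame hC c _
  have hZb : ∀ c', ∀ v ∈ O.merged.Λ c' (Mu O.merged), (φL κ Φ t p O.D O.DT O.ori (gOf κ Φ t p O (KS.gT 0 gx)) (fOf κ Φ t p O (KS.fT 0 fx))) v - (φL κ Φ t p O.D O.DT O.ori (gOf κ Φ t p O (KS.gT 0 gx)) (fOf κ Φ t p O (KS.fT 0 fx))) c' ∈ box 2 (Mu O.merged) := fun c' v hv =>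
    (Skelφ.mem_cyl (φL κ Φ t p O.D O.DT O.ori (gOf κ Φ t p O (KS.gT 0 gx)) (fOf κ Φ t p O (KS.fT 0 fx))) c' (Mu O.merged) v).1 (hZ c' (Finset.mem_coe.2 hv))
  have hRA := KS.RA'_eq κ Φ t p O.merged 0
  -- the fine lattice of record
  obtain ⟨hc₀, hc₁⟩ := prFA_c_pos κ Φ t p O.merged (gOf κ Φ t p O (KS.gT 0 gx)) (fOf κ Φ t p O (KS.fT 0 fx))
  have hD : 0 < (prFA κ Φ t p O.merged (gOf κ Φ t p O (KS.gT 0 gx)) (fOf κ Φ t p O (KS.fT 0 fx))).D := prFA_D_pos κ Φ t p O.merged (gOf κ Φ t p O (KS.gT 0 gx)) (fOf κ Φ t p O (KS.fT 0 fx)) hNL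
  have hDd := prFA_D κ Φ t p O.merged (gOf κ Φ t p O (KS.gT 0 gx)) (fOf κ Φ t p O (KS.fT 0 fx))
  have hn : (prFA κ Φ t p O.merged (gOf κ Φ t p O (KS.gT 0 gx)) (fOf κ Φ t p O (KS.fT 0 fx))).n = (nL κ Φ t p O.merged (gOf κ Φ t p O (KS.gT 0 gx)) (fOf κ Φ t p O (KS.fT 0 fx))) := (prFA_fields κ Φ t p O.merged (gOf κ Φ t p O (KS.gT 0 gx)) (fOf κ Φ t p O (KS.fT 0 fx))).2.1
  have hA : 0 < (prFA κ Φ t p O.merged (gOf κ Φ t p O (KS.gT 0 gx)) (fOf κ Φ t p O (KS.fT 0 fx))).A := (Aof_pos κ).1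
  have hL0' : (prFA κ Φ t p O.merged (gOf κ Φ t p O (KS.gT 0 gx)) (fOf κ Φ t p O (KS.fT 0 fx))).c₀ * (prFA κ Φ t p O.merged (gOf κ Φ t p O (KS.gT 0 gx)) (fOf κ Φ t p O (KS.fT 0 fx))).L 0 ≤ (prFA κ Φ t p O.merged (gOf κ Φ t p O (KS.gT 0 gx)) (fOf κ Φ t p O (KS.fT 0 fx))).D := by have h : (prFA κ Φ t p O.merged (gOf κ Φ t p O (KS.gT 0 gx)) (fOf κ Φ t p O (KS.fT 0 fx))).c₀ * (prFA κ Φ t p O.merged (gOf κ Φ t p O (KS.gT 0 gx)) (fOf κ Φ t p O (KS.fT 0 fx))).L 0 + 2 ≤ (prFA κ Φ t p O.merged (gOf κ Φ t p O (KS.gT 0 gx)) (fOf κ Φ t p O (KS.fT 0 fx))).D := cL_upperA κ Φ t p O.merged (gOf κ Φ t p O (KS.gT 0 gx)) (fOf κ Φ t p O (KS.fT 0 fx)) hNL 0; omega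
  have hL1' : (prFA κ Φ t p O.merged (gOf κ Φ t p O (KS.gT 0 gx)) (fOf κ Φ t p O (KS.fT 0 fx))).c₁ * (prFA κ Φ t p O.merged (gOf κ Φ t p O (KS.gT 0 gx)) (fOf κ Φ t p O (KS.fT 0 fx))).L 1 ≤ (prFA κ Φ t p O.merged (gOf κ Φ t p O (KS.gT 0 gx)) (fOf κ Φ t p O (KS.fT 0 fx))).D := by have h : (prFA κ Φ t p O.merged (gOf κ Φ t p O (KS.gT 0 gx)) (fOf κ Φ t p O (KS.fT 0 fx))).c₁ * (prFA κ Φ t p O.merged (gOf κ Φ t p O (KS.gT 0 gx)) (fOf κ Φ t p O (KS.fT 0 fx))).L 1 + 2 ≤ (prFA κ Φ t p O.merged (gOf κ Φ t p O (KS.gT 0 gx)) (fOf κ Φ t p O (KS.fT 0 fx))).D := cL_upperA κ Φ t p O.merged (gOf κ Φ t p O (KS.gT 0 gx)) (fOf κ Φ t p O (KS.fT 0 fx)) hNL 1; omega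
  have hlipψ : Lip G ((prFA κ Φ t p O.merged (gOf κ Φ t p O (KS.gT 0 gx)) (fOf κ Φ t p O (KS.fT 0 fx))).ψ (φL κ Φ t p O.D O.DT O.ori (gOf κ Φ t p O (KS.gT 0 gx)) (fOf κ Φ t p O (KS.fT 0 fx))) t) := (prFA κ Φ t p O.merged (gOf κ Φ t p O (KS.gT 0 gx)) (fOf κ Φ t p O (KS.fT 0 fx))).lip_ψ (lip_φL κ Φ t p O.D O.DT O.ori (gOf κ Φ t p O (KS.gT 0 gx)) (fOf κ Φ t p O (KS.fT 0 fx))) t hc₀.le hc₁.le hD hL0' hL1'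
  have hws : WeakSteps G ((prFA κ Φ t p O.merged (gOf κ Φ t p O (KS.gT 0 gx)) (fOf κ Φ t p O (KS.fT 0 fx))).ψ (φL κ Φ t p O.D O.DT O.ori (gOf κ Φ t p O (KS.gT 0 gx)) (fOf κ Φ t p O (KS.fT 0 fx))) t) := (prFA κ Φ t p O.merged (gOf κ Φ t p O (KS.gT 0 gx)) (fOf κ Φ t p O (KS.fT 0 fx))).weakSteps_ψ (steps_φL κ Φ t p O.D O.DT O.ori (gOf κ Φ t p O (KS.gT 0 gx)) (fOf κ Φ t p O (KS.fT 0 fx))) t hc₀.le hc₁.le hD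
  have hnz : ∀ du : MDir, (prFA κ Φ t p O.merged (gOf κ Φ t p O (KS.gT 0 gx)) (fOf κ Φ t p O (KS.fT 0 fx))).lvGen du.1 ((prFA κ Φ t p O.merged (gOf κ Φ t p O (KS.gT 0 gx)) (fOf κ Φ t p O (KS.fT 0 fx))).bOf du.1) ≠ 0 := fun du => (prFA κ Φ t p O.merged (gOf κ Φ t p O (KS.gT 0 gx)) (fOf κ Φ t p O (KS.fT 0 fx))).lvGen_bOf_ne_zero du.1 ((prFA κ Φ t p O.merged (gOf κ Φ t p O (KS.gT 0 gx)) (fOf κ Φ t p O (KS.fT 0 fx))).lvGen_ne_zero_of_detD_pos hDd hD du.1)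
  obtain ⟨hc0, hc1⟩ := prFA_c_eq κ Φ t p O.merged (gOf κ Φ t p O (KS.gT 0 gx)) (fOf κ Φ t p O (KS.fT 0 fx))
  have hκ₀ : (0 : ℤ) ≤ (((fcellsA κ Φ t p O.merged (gOf κ Φ t p O (KS.gT 0 gx)) (fOf κ Φ t p O (KS.fT 0 fx))).s 0 : ℕ) : ℤ) := Nat.cast_nonneg _
  have hmod : modulus (nL κ Φ t p O.merged (gOf κ Φ t p O (KS.gT 0 gx)) (fOf κ Φ t p O (KS.fT 0 fx))) (prFA κ Φ t p O.merged (gOf κ Φ t p O (KS.gT 0 gx)) (fOf κ Φ t p O (KS.fT 0 fx))).h (prFA κ Φ t p O.merged (gOf κ Φ t p O (KS.gT 0 gx)) (fOf κ Φ t p O (KS.fT 0 fx))).vα (prFA κ Φ t p O.merged (gOf κ Φ t p O (KS.gT 0 gx)) (fOf κ Φ t p O (KS.fT 0 fx))).vβ = modulus (nL κ Φ t p O.merged (gOf κ Φ t p O (KS.gT 0 gx)) (fOf κ Φ t p O (KS.fT 0 fx))) (hL κ Φ t p O.merged (gOf κ Φ t p O (KS.gT 0 gx)) (fOf κ Φ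 t p O (KS.fT 0 fx))) (vL κ Φ t p O.merged (gOf κ Φ t p O (KS.gT 0 gx)) (fOf κ Φ t p O (KS.fT 0 fx))) (vβL κ Φ t p O.merged (gOf κ Φ t p O (KS.gT 0 gx)) (fOf κ Φ t p O (KS.fT 0 fx))) := rfl
  have hmod0 : 0 < modulus (nL κ Φ t p O.merged (gOf κ Φ t p O (KS.gT 0 gx)) (fOf κ Φ t p O (KS.fT 0 fx))) (hL κ Φ t p O.merged (gOf κ Φ t p O (KS.gT 0 gx)) (fOf κ Φ t p O (KS.fT 0 fx))) (vL κ Φ t p O.merged (gOf κ Φ t p O (KS.gT 0 gx)) (fOf κ Φ t p O (KS.fT 0 fx))) (vβL κ Φ t p O.merged (gOf κ Φ t p O (KS.gT 0 gx)) (fOf κ Φ t p O (KS.fT 0 fx))) := Skelφ.NegPrm.modulus_vβOf_pos hnL1 hℓL1 _ _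
  have hDm : (prFA κ Φ t p O.merged (gOf κ Φ t p O (KS.gT 0 gx)) (fOf κ Φ t p O (KS.fT 0 fx))).D = (prFA κ Φ t p O.merged (gOf κ Φ t p O (KS.gT 0 gx)) (fOf κ Φ t p O (KS.fT 0 fx))).A ^ 2 * modulus (nL κ Φ t p O.merged (gOf κ Φ t p O (KS.gT 0 gx)) (fOf κ Φ t p O (KS.fT 0 fx))) (hL κ Φ t p O.merged (gOf κ Φ t p O (KS.gT 0 gx)) (fOf κ Φ t p O (KS.fT 0 fx))) (vL κ Φ t p O.merged (gOf κ Φ t p O (KS.gT 0 gx)) (fOf κ Φ t p O (KS.fT 0 fx))) (vβL κ Φ t p O.merged (gOf κ Φ t p O (KS.gT 0 gx)) (fOf κ Φ t p O (KS.fT 0 fx))) := D_eq_A_sq_mulA κ Φ t p O.merged (gOf κ Φ t p O (KS.gT 0 gx)) (fOf κ Φ t p O (KS.fT 0 fx))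
  obtain ⟨hmodlo, hmodhi⟩ := modulus_top κ Φ t p O.merged (gOf κ Φ t p O (KS.gT 0 gx)) (fOf κ Φ t p O (KS.fT 0 fx)) hnL1
  -- the window radius `L′` and the band `E`
  have hfl := floors_exA κ Φ t p O.merged (gOf κ Φ t p O (KS.gT 0 gx)) (fOf κ Φ t p O (KS.fT 0 fx))
  have hLp : (ex κ Φ t p O.merged (gOf κ Φ t p O (KS.gT 0 gx)) (fOf κ Φ t p O (KS.fT 0 fx))) ≤ (Skelφ.Prm.Lp (SUA ex mx κ Φ t p O.merged (gOf κ Φ t p O (KS.gT 0 gx)) (fOf κ Φ t p O (KS.fT 0 fx)) q)) := (ex_le_Lp_UA κ Φ t p O.merged (gOf κ Φ t p O (KS.gT 0 gx)) (fOf κ Φ t p O (KS.fT 0 fx)) ex mx q).1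
  have hL' : 1 ≤ (Skelφ.Prm.Lp (SUA ex mx κ Φ t p O.merged (gOf κ Φ t p O (KS.gT 0 gx)) (fOf κ Φ t p O (KS.fT 0 fx)) q)) := le_trans (by have := hfl.2.2.1; have := hex.1; omega) hLp
  have hE1 : 1 ≤ KS.RlevA κ Φ t p O.merged 0 + KS.reachA t O.merged 0 := by unfold KS.reachA; omega
  have hroomB := fun du : MDir => room_cast_aux hE1 (hroomF_RA κ Φ t p O.merged (gOf κ Φ t p O (KS.gT 0 gx)) (fOf κ Φ t p O (KS.fT 0 fx)) hNL (KS.RlevA κ Φ t p O.merged 0 + KS.reachA t O.merged 0 - 1) du)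
  -- the F-Λ zone reading (L-F2)
  have hKC : 11 * Mu O.merged ≤ KS.reachA t O.merged 0 := by unfold KS.reachA KS.KCmax; omega
  have hMe : ((Mu O.merged : ℕ) : ℤ) ≤ (KS.eF κ Φ t p O.merged cF 0 : ℤ) := by
    have h : Mu O.merged ≤ KS.eF κ Φ t p O.merged cF 0 := by unfold KS.eF; have := hRA.1; omega
    exact_mod_cast h
  have hΛZ2 := faceLam_zone κ Φ t p O.merged cF 0 (gOf κ Φ t p O (KS.gT 0 gx)) (fOf κ Φ t p O (KS.fT 0 fx)) hNL hMe
  have hZk := Skelφ.zone_fine_le_of_lam (φ := (φL κ Φ t p O.D O.DT O.ori (gOf κ Φ t p O (KS.gT 0 gx)) (fOf κ Φ t p O (KS.fT 0 fx)))) (kA := (fun i : Fin 2 => if i = 0 then KS.kF₀A κ Φ t p O.merged cF 0 (gOf κ Φ t p O (KS.gT 0 gx)) (fOf κ Φ t p O (KS.fT 0 fx)) else KS.kF₁A κ Φ t p O.merged cF 0 (gOf κ Φ t p O (KS.gT 0 gx)) (fOf κ Φ t p O (KS.fT 0 fx)))) (prFA κ Φ t p O.merged (gOf κ Φ t p O (KS.gT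 0 gx)) (fOf κ Φ t p O (KS.fT 0 fx))) hn hD hc₀.le hc₁.le hΛZ2
    (KS.hkF0_RA κ Φ t p O.merged cF 0 (gOf κ Φ t p O (KS.gT 0 gx)) (fOf κ Φ t p O (KS.fT 0 fx)) hNL) (KS.hkF1_RA κ Φ t p O.merged cF 0 (gOf κ Φ t p O (KS.gT 0 gx)) (fOf κ Φ t p O (KS.fT 0 fx)) hNL) (fun c' => O.merged.Λ c' (Mu O.merged)) hZb
  -- the x-face numbers with their counts exposed
  have HX : ∀ (a' : ℕ) (x : Site 2) (du : MDir) (j : ℕ) (pc : ℤ) (c' : V), du.1 = 0 → j < (fcellsA κ Φ t p O.merged (gOf κ Φ t p O (KS.gT 0 gx)) (fOf κ Φ t p O (KS.fT 0 fx))).K → ∀ yF : V,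
      (prFA κ Φ t p O.merged (gOf κ Φ t p O (KS.gT 0 gx)) (fOf κ Φ t p O (KS.fT 0 fx))).ψ (φL κ Φ t p O.D O.DT O.ori (gOf κ Φ t p O (KS.gT 0 gx)) (fOf κ Φ t p O (KS.fT 0 fx))) t yF = (fcellsA κ Φ t p O.merged (gOf κ Φ t p O (KS.gT 0 gx)) (fOf κ Φ t p O (KS.fT 0 fx))).faceCen x du j → pc = relφ (φL κ Φ t p O.D O.DT O.ori (gOf κ Φ t p O (KS.gT 0 gx)) (fOf κ Φ t p O (KS.fT 0 fx))) t yF ((prFA κ Φ t p O.merged (gOf κ Φ t p O (KS.gT 0 gx)) (fOf κ Φ t p O (KS.fT 0 fx))).bOf du.1) →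
      (prFA κ Φ t p O.merged (gOf κ Φ t p O (KS.gT 0 gx)) (fOf κ Φ t p O (KS.fT 0 fx))).frame (φL κ Φ t p O.D O.DT O.ori (gOf κ Φ t p O (KS.gT 0 gx)) (fOf κ Φ t p O (KS.fT 0 fx))) t du.1 ((prFA κ Φ t p O.merged (gOf κ Φ t p O (KS.gT 0 gx)) (fOf κ Φ t p O (KS.fT 0 fx))).bOf du.1) c' ∈ Finset.Icc (loN (fcellsA κ Φ t p O.merged (gOf κ Φ t p O (KS.gT 0 gx)) (fOf κ Φ t p O (KS.fT 0 fx))) x du j pc ((fun du : MDir => ((prFA κ Φ t p O.merged (gOf κ Φ t p O (KS.gT 0 gx)) (fOf κ Φ t p O (KS.fT 0 fx))).awF₂ (fcellsA κ Φ t p O.merged (gOf κ Φ t p O (KS.gT 0 gx)) (fOf κ Φ t p O (KS.fT 0 fx))) du).toNat) du) - (((KS.RlevA κ Φ t p O.merged 0 + KS.reachA t O.merged 0) : ℕ) : Site 2)) (hiN (fcellsA κ Φ t p O.merged (gOf κ Φ t p O (KS.gT 0 gx)) (fOf κ Φ t p O (KS.fT 0 fx))) x du j pc ((fun du : MDir =>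 ((prFA κ Φ t p O.merged (gOf κ Φ t p O (KS.gT 0 gx)) (fOf κ Φ t p O (KS.fT 0 fx))).awF₂ (fcellsA κ Φ t p O.merged (gOf κ Φ t p O (KS.gT 0 gx)) (fOf κ Φ t p O (KS.fT 0 fx))) du).toNat) du) + (((KS.RlevA κ Φ t p O.merged 0 + KS.reachA t O.merged 0) : ℕ) : Site 2)) →
      c' ∈ graphBall G t ((concRadii2N (fcellsA κ Φ t p O.merged (gOf κ Φ t p O (KS.gT 0 gx)) (fOf κ Φ t p O (KS.fT 0 fx))) (Skelφ.Prm.gap ((SUA ex mx) κ Φ t p O.merged (gOf κ Φ t p O (KS.gT 0 gx)) (fOf κ Φ t p O (KS.fT 0 fx)) q)) (fun _ : ℕ => (0:ℕ)) (Skelφ.Prm.E₀ ((SUA ex mx) κ Φ t p O.merged (gOf κ Φ t p O (KS.gT 0 gx)) (fOf κ Φ t p O (KS.fT 0 fx)) q)) (Skelφ.Prm.Lp ((SUA ex mx) κ Φ t p O.merged (gOf κ Φ t p O (KS.gT 0 gx)) (fOf κ Φ t p O (KS.fT 0 fx)) q)) (offNA κ Φ t p O.merged (gOf κ Φ t p O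 (KS.gT 0 gx)) (fOf κ Φ t p O (KS.fT 0 fx)))).rE a' x du - (Skelφ.Prm.Lp (SUA ex mx κ Φ t p O.merged (gOf κ Φ t p O (KS.gT 0 gx)) (fOf κ Φ t p O (KS.fT 0 fx)) q))) →
      (Skelφ.Prm.Lp ((SUA ex mx) κ Φ t p O.merged (gOf κ Φ t p O (KS.gT 0 gx)) (fOf κ Φ t p O (KS.fT 0 fx)) q)) ≤ (concRadii2N (fcellsA κ Φ t p O.merged (gOf κ Φ t p O (KS.gT 0 gx)) (fOf κ Φ t p O (KS.fT 0 fx))) (Skelφ.Prm.gap ((SUA ex mx) κ Φ t p O.merged (gOf κ Φ t p O (KS.gT 0 gx)) (fOf κ Φ t p O (KS.fT 0 fx)) q)) (fun _ : ℕ => (0:ℕ)) (Skelφ.Prm.E₀ ((SUA ex mx) κ Φ t p O.merged (gOf κ Φ t p O (KS.gT 0 gx)) (fOf κ Φ t p O (KS.fT 0 fx)) q)) (Skelφ.Prm.Lp ((SUA ex mx) κ Φ t p O.merged (gOf κ Φ t p O (KS.gT 0 gx)) (fOf κ Φ t p O (KS.fT 0 fx)) q)) (offNA κ Φ t p O.merged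 (gOf κ Φ t p O (KS.gT 0 gx)) (fOf κ Φ t p O (KS.fT 0 fx)))).rM a' (x + stepVec du) → (Skelφ.Prm.Lp (SUA ex mx κ Φ t p O.merged (gOf κ Φ t p O (KS.gT 0 gx)) (fOf κ Φ t p O (KS.fT 0 fx)) q)) ≤ (concRadii2N (fcellsA κ Φ t p O.merged (gOf κ Φ t p O (KS.gT 0 gx)) (fOf κ Φ t p O (KS.fT 0 fx))) (Skelφ.Prm.gap ((SUA ex mx) κ Φ t p O.merged (gOf κ Φ t p O (KS.gT 0 gx)) (fOf κ Φ t p O (KS.fT 0 fx)) q)) (fun _ : ℕ => (0:ℕ)) (Skelφ.Prm.E₀ ((SUA ex mx) κ Φ t p O.merged (gOf κ Φ t p O (KS.gT 0 gx)) (fOf κ Φ t p O (KS.fT 0 fx)) q)) (Skelφ.Prm.Lp ((SUA ex mx) κ Φ t p O.merged (gOf κ Φ t p O (KS.gT 0 gx)) (fOf κ Φ t p O (KS.fT 0 fx)) q)) (offNA κ Φ t p O.merged (gOf κ Φ t p O (KS.gT 0 gx)) (fOf κ Φ t p O (KS.fT 0 fx)))).rE a' x du →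
      ∃ N : FaceRunNumsX4 G (φL κ Φ t p O.D O.DT O.ori (gOf κ Φ t p O (KS.gT 0 gx)) (fOf κ Φ t p O (KS.fT 0 fx))) ((prFA κ Φ t p O.merged (gOf κ Φ t p O (KS.gT 0 gx)) (fOf κ Φ t p O (KS.fT 0 fx))).ψ (φL κ Φ t p O.D O.DT O.ori (gOf κ Φ t p O (KS.gT 0 gx)) (fOf κ Φ t p O (KS.fT 0 fx))) t) c' (prFA κ Φ t p O.merged (gOf κ Φ t p O (KS.gT 0 gx)) (fOf κ Φ t p O (KS.fT 0 fx))).A (nL κ Φ t p O.merged (gOf κ Φ t p O (KS.gT 0 gx)) (fOf κ Φ t p O (KS.fT 0 fx))) (prFA κ Φ t p O.merged (gOf κ Φ t p O (KS.gT 0 gx)) (fOf κ Φ t p O (KS.fT 0 fx))).h (prFA κ Φ t p O.merged (gOf κ Φ t p O (KS.gT 0 gx)) (fOf κ Φ t p O (KS.fT 0 fx))).vα (prFA κ Φ t p O.merged (gOf κ Φ t p O (KS.gT 0 gx)) (fOf κ Φ t p O (KS.fT 0 fx))).vβ (prFA κ Φ t p O.merged (gOf κ Φ t p O (KS.gT 0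 gx)) (fOf κ Φ t p O (KS.fT 0 fx))).c₀ (prFA κ Φ t p O.merged (gOf κ Φ t p O (KS.gT 0 gx)) (fOf κ Φ t p O (KS.fT 0 fx))).c₁ (prFA κ Φ t p O.merged (gOf κ Φ t p O (KS.gT 0 gx)) (fOf κ Φ t p O (KS.fT 0 fx))).D du (sgOf du) ((fun σ' : ℤ => KS.BFt κ Φ t p O.merged cF 0 (gOf κ Φ t p O (KS.gT 0 gx)) (fOf κ Φ t p O (KS.fT 0 fx)) σ') (sgOf du)) (ℓL κ Φ t p O.merged (gOf κ Φ t p O (KS.gT 0 gx)) (fOf κ Φ t p O (KS.fT 0 fx))) (KS.RA' κ Φ t p O.merged 0) qB (KS.RA' κ Φ t p O.merged 0) qB₃ (prFA κ Φ t p O.merged (gOf κ Φ t p O (KS.gT 0 gx)) (fOf κ Φ t p O (KS.fT 0 fx))).vα (one_le_nL_of_atQOS (atQOS_of_atQOTA hAt)) (abs_vL_le_of_atQOS (atQOS_of_atQOTA hAt)) (layer_of_atQOS (atQOS_of_atQOTA hAt)) (Mu O.merged)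
        ((fcellsA κ Φ t p O.merged (gOf κ Φ t p O (KS.gT 0 gx)) (fOf κ Φ t p O (KS.fT 0 fx))).farCore x du j (3 : ℤ)) (targetMM G (φL κ Φ t p O.D O.DT O.ori (gOf κ Φ t p O (KS.gT 0 gx)) (fOf κ Φ t p O (KS.fT 0 fx))) (prFA κ Φ t p O.merged (gOf κ Φ t p O (KS.gT 0 gx)) (fOf κ Φ t p O (KS.fT 0 fx))) (fcellsA κ Φ t p O.merged (gOf κ Φ t p O (KS.gT 0 gx)) (fOf κ Φ t p O (KS.fT 0 fx))) t (concRadii2N (fcellsA κ Φ t p O.merged (gOf κ Φ t p O (KS.gT 0 gx)) (fOf κ Φ t p O (KS.fT 0 fx))) (Skelφ.Prm.gap ((SUA ex mx) κ Φ t p O.merged (gOf κ Φ t p O (KS.gT 0 gx)) (fOf κ Φ t p O (KS.fT 0 fx)) q)) (fun _ : ℕ => (0:ℕ)) (Skelφ.Prm.E₀ ((SUA ex mx) κ Φ t p O.merged (gOf κ Φ t p O (KS.gT 0 gx)) (fOf κ Φ t p O (KS.fT 0 fx)) q)) (Skelφ.Prm.Lp ((SUA ex mx) κ Φ t p O.merged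 (gOf κ Φ t p O (KS.gT 0 gx)) (fOf κ Φ t p O (KS.fT 0 fx)) q)) (offNA κ Φ t p O.merged (gOf κ Φ t p O (KS.gT 0 gx)) (fOf κ Φ t p O (KS.fT 0 fx)))) (b0TA κ Φ t p O.merged (gOf κ Φ t p O (KS.gT 0 gx)) (fOf κ Φ t p O (KS.fT 0 fx))) a' x du (Skelφ.Prm.Lp ((SUA ex mx) κ Φ t p O.merged (gOf κ Φ t p O (KS.gT 0 gx)) (fOf κ Φ t p O (KS.fT 0 fx)) q))) (O.merged.Λ c' (Mu O.merged)) (Skelφ.Prm.Lp (SUA ex mx κ Φ t p O.merged (gOf κ Φ t p O (KS.gT 0 gx)) (fOf κ Φ t p O (KS.fT 0 fx)) q)) ((fun i : Fin 2 => if i = 0 then KS.kF₀A κ Φ t p O.merged cF 0 (gOf κ Φ t p O (KS.gT 0 gx)) (fOf κ Φ t p O (KS.fT 0 fx)) else KS.kF₁A κ Φ t p O.merged cF 0 (gOf κ Φ t p O (KS.gT 0 gx)) (fOf κ Φ t p O (KS.fT 0 fx))) du.1) ((fun i : Fin 2 => if i = 0 then KS.kF₀A κ Φ t p O.merged cF 0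 (gOf κ Φ t p O (KS.gT 0 gx)) (fOf κ Φ t p O (KS.fT 0 fx)) else KS.kF₁A κ Φ t p O.merged cF 0 (gOf κ Φ t p O (KS.gT 0 gx)) (fOf κ Φ t p O (KS.fT 0 fx))) (oth du.1)), N.Nr = NrF x du j ((prFA κ Φ t p O.merged (gOf κ Φ t p O (KS.gT 0 gx)) (fOf κ Φ t p O (KS.fT 0 fx))).ψ (φL κ Φ t p O.D O.DT O.ori (gOf κ Φ t p O (KS.gT 0 gx)) (fOf κ Φ t p O (KS.fT 0 fx))) t c') ∧ N.N₃ = N3F x du j ((prFA κ Φ t p O.merged (gOf κ Φ t p O (KS.gT 0 gx)) (fOf κ Φ t p O (KS.fT 0 fx))).ψ (φL κ Φ t p O.D O.DT O.ori (gOf κ Φ t p O (KS.gT 0 gx)) (fOf κ Φ t p O (KS.fT 0 fx))) t c') := by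
    intro a' x du j pc c' hI hj yF hyF hpc hbox hball hM hE
    obtain ⟨hL1, hL2, hwc⟩ := Skelφ.cell_of_frame_box (φ := (φL κ Φ t p O.D O.DT O.ori (gOf κ Φ t p O (KS.gT 0 gx)) (fOf κ Φ t p O (KS.fT 0 fx)))) (prFA κ Φ t p O.merged (gOf κ Φ t p O (KS.gT 0 gx)) (fOf κ Φ t p O (KS.fT 0 fx))) t hc₀ hc₁ hD (fcellsA κ Φ t p O.merged (gOf κ Φ t p O (KS.gT 0 gx)) (fOf κ Φ t p O (KS.fT 0 fx))) (hnz du) hyF hpc (hroomB du) hbox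
    have FX := floorsX x du j ((prFA κ Φ t p O.merged (gOf κ Φ t p O (KS.gT 0 gx)) (fOf κ Φ t p O (KS.fT 0 fx))).ψ (φL κ Φ t p O.D O.DT O.ori (gOf κ Φ t p O (KS.gT 0 gx)) (fOf κ Φ t p O (KS.fT 0 fx))) t c') hI hj hL1 hL2 hwc
    exact Skelφ.numsX_of_floors₂E (steps_φL κ Φ t p O.D O.DT O.ori (gOf κ Φ t p O (KS.gT 0 gx)) (fOf κ Φ t p O (KS.fT 0 fx))) (prFA κ Φ t p O.merged (gOf κ Φ t p O (KS.gT 0 gx)) (fOf κ Φ t p O (KS.fT 0 fx))) t hn (one_le_nL_of_atQOS hAtS) (abs_vL_le_of_atQOS hAtS) hD hlipψ hws hA hκ₀ (abs_vL_le_of_atQOS hAtS) hc0 hc1 hmod hmod0 hDm (layer_of_atQOS hAtS) hmodlo hmodhi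
      (fcellsA κ Φ t p O.merged (gOf κ Φ t p O (KS.gT 0 gx)) (fOf κ Φ t p O (KS.fT 0 fx))) _ (b0TA κ Φ t p O.merged (gOf κ Φ t p O (KS.gT 0 gx)) (fOf κ Φ t p O (KS.fT 0 fx))) a' x du hI j hL' hM (by norm_num) c' hball hE (Mu O.merged) le_rfl (le_of_eq (by ring)) (le_of_eq (by ring)) (le_of_eq (by ring))
      FX.hfR (O.merged.Λ c' (Mu O.merged)) (hZk c' du) FX.hZfar ((fun σ' : ℤ => KS.BFt κ Φ t p O.merged cF 0 (gOf κ Φ t p O (KS.gT 0 gx)) (fOf κ Φ t p O (KS.fT 0 fx)) σ') (sgOf du)) (KS.RA' κ Φ t p O.merged 0) qB (KS.RA' κ Φ t p O.merged 0) qB₃ (yLF x du j ((prFA κ Φ t p O.merged (gOf κ Φ t p O (KS.gT 0 gx)) (fOf κ Φ t p O (KS.fT 0 fx))).ψ (φL κ Φ t p O.D O.DT O.ori (gOf κ Φ t p O (KS.gT 0 gx)) (fOf κ Φ t p O (KS.fT 0 fx))) t c')) (NrF x du j ((prFA κ Φ t p O.merged (gOf κ Φ t p O (KS.gT 0 gx))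 (fOf κ Φ t p O (KS.fT 0 fx))).ψ (φL κ Φ t p O.D O.DT O.ori (gOf κ Φ t p O (KS.gT 0 gx)) (fOf κ Φ t p O (KS.fT 0 fx))) t c')) (N3F x du j ((prFA κ Φ t p O.merged (gOf κ Φ t p O (KS.gT 0 gx)) (fOf κ Φ t p O (KS.fT 0 fx))).ψ (φL κ Φ t p O.D O.DT O.ori (gOf κ Φ t p O (KS.gT 0 gx)) (fOf κ Φ t p O (KS.fT 0 fx))) t c'))
      FX.hσT FX.FX1 FX.FX2 FX.FX3 FX.FX4 FX.FX5 FX.FX6 FX.FY1 FX.FY2 FX.FY3 FX.FY4 FX.FY5 FX.FY6 FX.FL1 FX.FL2 FX.FL3 FX.FL4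
      FX.hfit FX.hq₃ FX.hxaX FX.hxbX FX.hclr FX.hclr₃ FX.hπ2X FX.hπ3X
  -- the y′-face numbers with their counts exposed
  have HY : ∀ (a' : ℕ) (x : Site 2) (du : MDir) (j : ℕ) (pc : ℤ) (c' : V), du.1 = 1 → j < (fcellsA κ Φ t p O.merged (gOf κ Φ t p O (KS.gT 0 gx)) (fOf κ Φ t p O (KS.fT 0 fx))).K → ∀ yF : V,
      (prFA κ Φ t p O.merged (gOf κ Φ t p O (KS.gT 0 gx)) (fOf κ Φ t p O (KS.fT 0 fx))).ψ (φL κ Φ t p O.D O.DT O.ori (gOf κ Φ t p O (KS.gT 0 gx)) (fOf κ Φ t p O (KS.fT 0 fx))) t yF = (fcellsA κ Φ t p O.merged (gOf κ Φ t p O (KS.gT 0 gx)) (fOf κ Φ t p O (KS.fT 0 fx))).faceCen x du j → pc = relφ (φL κ Φ t p O.D O.DT O.ori (gOf κ Φ t p O (KS.gT 0 gx)) (fOf κ Φ t p O (KS.fT 0 fx))) t yF ((prFA κ Φ t p O.merged (gOf κ Φ t p O (KS.gT 0 gx)) (fOf κ Φ t p O (KS.fT 0 fx))).bOf du.1) 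→
      (prFA κ Φ t p O.merged (gOf κ Φ t p O (KS.gT 0 gx)) (fOf κ Φ t p O (KS.fT 0 fx))).frame (φL κ Φ t p O.D O.DT O.ori (gOf κ Φ t p O (KS.gT 0 gx)) (fOf κ Φ t p O (KS.fT 0 fx))) t du.1 ((prFA κ Φ t p O.merged (gOf κ Φ t p O (KS.gT 0 gx)) (fOf κ Φ t p O (KS.fT 0 fx))).bOf du.1) c' ∈ Finset.Icc (loN (fcellsA κ Φ t p O.merged (gOf κ Φ t p O (KS.gT 0 gx)) (fOf κ Φ t p O (KS.fT 0 fx))) x du j pc ((fun du : MDir => ((prFA κ Φ t p O.merged (gOf κ Φ t p O (KS.gT 0 gx)) (fOf κ Φ t p O (KS.fT 0 fx))).awF₂ (fcellsA κ Φ t p O.merged (gOf κ Φ t p O (KS.gT 0 gx)) (fOf κ Φ t p O (KS.fT 0 fx))) du).toNat) du) - (((KS.RlevA κ Φ t p O.merged 0 + KS.reachA t O.merged 0) : ℕ) : Site 2)) (hiN (fcellsA κ Φ t p O.merged (gOf κ Φ t p O (KS.gT 0 gx)) (fOf κ Φ t p O (KS.fT 0 fx))) x du j pc ((fun du : MDir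 => ((prFA κ Φ t p O.merged (gOf κ Φ t p O (KS.gT 0 gx)) (fOf κ Φ t p O (KS.fT 0 fx))).awF₂ (fcellsA κ Φ t p O.merged (gOf κ Φ t p O (KS.gT 0 gx)) (fOf κ Φ t p O (KS.fT 0 fx))) du).toNat) du) + (((KS.RlevA κ Φ t p O.merged 0 + KS.reachA t O.merged 0) : ℕ) : Site 2)) →
      c' ∈ graphBall G t ((concRadii2N (fcellsA κ Φ t p O.merged (gOf κ Φ t p O (KS.gT 0 gx)) (fOf κ Φ t p O (KS.fT 0 fx))) (Skelφ.Prm.gap ((SUA ex mx) κ Φ t p O.merged (gOf κ Φ t p O (KS.gT 0 gx)) (fOf κ Φ t p O (KS.fT 0 fx)) q)) (fun _ : ℕ => (0:ℕ)) (Skelφ.Prm.E₀ ((SUA ex mx) κ Φ t p O.merged (gOf κ Φ t p O (KS.gT 0 gx)) (fOf κ Φ t p O (KS.fT 0 fx)) q)) (Skelφ.Prm.Lp ((SUA ex mx) κ Φ t p O.merged (gOf κ Φ t p O (KS.gT 0 gx)) (fOf κ Φ t p O (KS.fT 0 fx)) q)) (offNA κ Φ t p O.merged (gOf κ Φ t p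 O (KS.gT 0 gx)) (fOf κ Φ t p O (KS.fT 0 fx)))).rE a' x du - (Skelφ.Prm.Lp (SUA ex mx κ Φ t p O.merged (gOf κ Φ t p O (KS.gT 0 gx)) (fOf κ Φ t p O (KS.fT 0 fx)) q))) →
      (Skelφ.Prm.Lp ((SUA ex mx) κ Φ t p O.merged (gOf κ Φ t p O (KS.gT 0 gx)) (fOf κ Φ t p O (KS.fT 0 fx)) q)) ≤ (concRadii2N (fcellsA κ Φ t p O.merged (gOf κ Φ t p O (KS.gT 0 gx)) (fOf κ Φ t p O (KS.fT 0 fx))) (Skelφ.Prm.gap ((SUA ex mx) κ Φ t p O.merged (gOf κ Φ t p O (KS.gT 0 gx)) (fOf κ Φ t p O (KS.fT 0 fx)) q)) (fun _ : ℕ => (0:ℕ)) (Skelφ.Prm.E₀ ((SUA ex mx) κ Φ t p O.merged (gOf κ Φ t p O (KS.gT 0 gx)) (fOf κ Φ t p O (KS.fT 0 fx)) q)) (Skelφ.Prm.Lp ((SUA ex mx) κ Φ t p O.merged (gOf κ Φ t p O (KS.gT 0 gx)) (fOf κ Φ t p O (KS.fT 0 fx)) q)) (offNA κ Φ t p O.merged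 (gOf κ Φ t p O (KS.gT 0 gx)) (fOf κ Φ t p O (KS.fT 0 fx)))).rM a' (x + stepVec du) → (Skelφ.Prm.Lp (SUA ex mx κ Φ t p O.merged (gOf κ Φ t p O (KS.gT 0 gx)) (fOf κ Φ t p O (KS.fT 0 fx)) q)) ≤ (concRadii2N (fcellsA κ Φ t p O.merged (gOf κ Φ t p O (KS.gT 0 gx)) (fOf κ Φ t p O (KS.fT 0 fx))) (Skelφ.Prm.gap ((SUA ex mx) κ Φ t p O.merged (gOf κ Φ t p O (KS.gT 0 gx)) (fOf κ Φ t p O (KS.fT 0 fx)) q)) (fun _ : ℕ => (0:ℕ)) (Skelφ.Prm.E₀ ((SUA ex mx) κ Φ t p O.merged (gOf κ Φ t p O (KS.gT 0 gx)) (fOf κ Φ t p O (KS.fT 0 fx)) q)) (Skelφ.Prm.Lp ((SUA ex mx) κ Φ t p O.merged (gOf κ Φ t p O (KS.gT 0 gx)) (fOf κ Φ t p O (KS.fT 0 fx)) q)) (offNA κ Φ t p O.merged (gOf κ Φ t p O (KS.gT 0 gx)) (fOf κ Φ t p O (KS.fT 0 fx)))).rE a' x du →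
      ∃ N : FaceRunNumsY4 G (φL κ Φ t p O.D O.DT O.ori (gOf κ Φ t p O (KS.gT 0 gx)) (fOf κ Φ t p O (KS.fT 0 fx))) ((prFA κ Φ t p O.merged (gOf κ Φ t p O (KS.gT 0 gx)) (fOf κ Φ t p O (KS.fT 0 fx))).ψ (φL κ Φ t p O.D O.DT O.ori (gOf κ Φ t p O (KS.gT 0 gx)) (fOf κ Φ t p O (KS.fT 0 fx))) t) c' (prFA κ Φ t p O.merged (gOf κ Φ t p O (KS.gT 0 gx)) (fOf κ Φ t p O (KS.fT 0 fx))).A (nL κ Φ t p O.merged (gOf κ Φ t p O (KS.gT 0 gx)) (fOf κ Φ t p O (KS.fT 0 fx))) (prFA κ Φ t p O.merged (gOf κ Φ t p O (KS.gT 0 gx)) (fOf κ Φ t p O (KS.fT 0 fx))).h (prFA κ Φ t p O.merged (gOf κ Φ t p O (KS.gT 0 gx)) (fOf κ Φ t p O (KS.fT 0 fx))).vα (prFA κ Φ t p O.merged (gOf κ Φ t p O (KS.gT 0 gx)) (fOf κ Φ t p O (KS.fT 0 fx))).vβ (prFA κ Φ t p O.merged (gOf κ Φ t p O (KS.gT 0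 gx)) (fOf κ Φ t p O (KS.fT 0 fx))).c₀ (prFA κ Φ t p O.merged (gOf κ Φ t p O (KS.gT 0 gx)) (fOf κ Φ t p O (KS.fT 0 fx))).c₁ (prFA κ Φ t p O.merged (gOf κ Φ t p O (KS.gT 0 gx)) (fOf κ Φ t p O (KS.fT 0 fx))).D du (σhF du) (sgOf du) ((fun σ' : ℤ => KS.BFt κ Φ t p O.merged cF 0 (gOf κ Φ t p O (KS.gT 0 gx)) (fOf κ Φ t p O (KS.fT 0 fx)) σ') (σhF du)) (ℓL κ Φ t p O.merged (gOf κ Φ t p O (KS.gT 0 gx)) (fOf κ Φ t p O (KS.fT 0 fx))) (KS.RA' κ Φ t p O.merged 0) qB' (KS.RA' κ Φ t p O.merged 0) qB₃' (prFA κ Φ t p O.merged (gOf κ Φ t p O (KS.gT 0 gx)) (fOf κ Φ t p O (KS.fT 0 fx))).vα (one_le_nL_of_atQOS (atQOS_of_atQOTA hAt)) (abs_vL_le_of_atQOS (atQOS_of_atQOTA hAt))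
        (layer_of_atQOS (atQOS_of_atQOTA hAt)) (Mu O.merged) ((fcellsA κ Φ t p O.merged (gOf κ Φ t p O (KS.gT 0 gx)) (fOf κ Φ t p O (KS.fT 0 fx))).farCore x du j (3 : ℤ)) (targetMM G (φL κ Φ t p O.D O.DT O.ori (gOf κ Φ t p O (KS.gT 0 gx)) (fOf κ Φ t p O (KS.fT 0 fx))) (prFA κ Φ t p O.merged (gOf κ Φ t p O (KS.gT 0 gx)) (fOf κ Φ t p O (KS.fT 0 fx))) (fcellsA κ Φ t p O.merged (gOf κ Φ t p O (KS.gT 0 gx)) (fOf κ Φ t p O (KS.fT 0 fx))) t (concRadii2N (fcellsA κ Φ t p O.merged (gOf κ Φ t p O (KS.gT 0 gx)) (fOf κ Φ t p O (KS.fT 0 fx))) (Skelφ.Prm.gap ((SUA ex mx) κ Φ t p O.merged (gOf κ Φ t p O (KS.gT 0 gx)) (fOf κ Φ t p O (KS.fT 0 fx)) q)) (fun _ : ℕ => (0:ℕ)) (Skelφ.Prm.E₀ ((SUA ex mx) κ Φ t p O.merged (gOf κ Φ t p O (KS.gT 0 gx)) (fOf κ Φ t p O (KS.fT 0 fx)) q))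 (Skelφ.Prm.Lp ((SUA ex mx) κ Φ t p O.merged (gOf κ Φ t p O (KS.gT 0 gx)) (fOf κ Φ t p O (KS.fT 0 fx)) q)) (offNA κ Φ t p O.merged (gOf κ Φ t p O (KS.gT 0 gx)) (fOf κ Φ t p O (KS.fT 0 fx)))) (b0TA κ Φ t p O.merged (gOf κ Φ t p O (KS.gT 0 gx)) (fOf κ Φ t p O (KS.fT 0 fx))) a' x du (Skelφ.Prm.Lp ((SUA ex mx) κ Φ t p O.merged (gOf κ Φ t p O (KS.gT 0 gx)) (fOf κ Φ t p O (KS.fT 0 fx)) q))) (O.merged.Λ c' (Mu O.merged)) (Skelφ.Prm.Lp (SUA ex mx κ Φ t p O.merged (gOf κ Φ t p O (KS.gT 0 gx)) (fOf κ Φ t p O (KS.fT 0 fx)) q)) ((fun i : Fin 2 => if i = 0 then KS.kF₀A κ Φ t p O.merged cF 0 (gOf κ Φ t p O (KS.gT 0 gx)) (fOf κ Φ t p O (KS.fT 0 fx)) else KS.kF₁A κ Φ t p O.merged cF 0 (gOf κ Φ t p O (KS.gT 0 gx)) (fOf κ Φ t p O (KS.fT 0 fx))) du.1) ((fun i : Fin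 2 => if i = 0 then KS.kF₀A κ Φ t p O.merged cF 0 (gOf κ Φ t p O (KS.gT 0 gx)) (fOf κ Φ t p O (KS.fT 0 fx)) else KS.kF₁A κ Φ t p O.merged cF 0 (gOf κ Φ t p O (KS.gT 0 gx)) (fOf κ Φ t p O (KS.fT 0 fx))) (oth du.1)), N.Nr = NrF' x du j ((prFA κ Φ t p O.merged (gOf κ Φ t p O (KS.gT 0 gx)) (fOf κ Φ t p O (KS.fT 0 fx))).ψ (φL κ Φ t p O.D O.DT O.ori (gOf κ Φ t p O (KS.gT 0 gx)) (fOf κ Φ t p O (KS.fT 0 fx))) t c') ∧ N.N₃ = N3F' x du j ((prFA κ Φ t p O.merged (gOf κ Φ t p O (KS.gT 0 gx)) (fOf κ Φ t p O (KS.fT 0 fx))).ψ (φL κ Φ t p O.D O.DT O.ori (gOf κ Φ t p O (KS.gT 0 gx)) (fOf κ Φ t p O (KS.fT 0 fx))) t c') := by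
    intro a' x du j pc c' hI hj yF hyF hpc hbox hball hM hE
    obtain ⟨hL1, hL2, hwc⟩ := Skelφ.cell_of_frame_box (φ := (φL κ Φ t p O.D O.DT O.ori (gOf κ Φ t p O (KS.gT 0 gx)) (fOf κ Φ t p O (KS.fT 0 fx)))) (prFA κ Φ t p O.merged (gOf κ Φ t p O (KS.gT 0 gx)) (fOf κ Φ t p O (KS.fT 0 fx))) t hc₀ hc₁ hD (fcellsA κ Φ t p O.merged (gOf κ Φ t p O (KS.gT 0 gx)) (fOf κ Φ t p O (KS.fT 0 fx))) (hnz du) hyF hpc (hroomB du) hbox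
    have FY := floorsY x du j ((prFA κ Φ t p O.merged (gOf κ Φ t p O (KS.gT 0 gx)) (fOf κ Φ t p O (KS.fT 0 fx))).ψ (φL κ Φ t p O.D O.DT O.ori (gOf κ Φ t p O (KS.gT 0 gx)) (fOf κ Φ t p O (KS.fT 0 fx))) t c') hI hj hL1 hL2 hwc
    exact Skelφ.numsY_of_floors₂E (steps_φL κ Φ t p O.D O.DT O.ori (gOf κ Φ t p O (KS.gT 0 gx)) (fOf κ Φ t p O (KS.fT 0 fx))) (prFA κ Φ t p O.merged (gOf κ Φ t p O (KS.gT 0 gx)) (fOf κ Φ t p O (KS.fT 0 fx))) t hn (one_le_nL_of_atQOS hAtS) (abs_vL_le_of_atQOS hAtS) hD hlipψ hws hA hκ₀ (abs_vL_le_of_atQOS hAtS) hc0 hc1 hmod hmod0 hDm (layer_of_atQOS hAtS) hmodlo hmodhi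
      (fcellsA κ Φ t p O.merged (gOf κ Φ t p O (KS.gT 0 gx)) (fOf κ Φ t p O (KS.fT 0 fx))) _ (b0TA κ Φ t p O.merged (gOf κ Φ t p O (KS.gT 0 gx)) (fOf κ Φ t p O (KS.fT 0 fx))) a' x du hI j hL' hM (by norm_num) c' hball hE (Mu O.merged) le_rfl (le_of_eq (by ring)) (le_of_eq (by ring)) (le_of_eq (by ring))
      FY.hfR (O.merged.Λ c' (Mu O.merged)) (hZk c' du) FY.hZfar FY.hσh ((fun σ' : ℤ => KS.BFt κ Φ t p O.merged cF 0 (gOf κ Φ t p O (KS.gT 0 gx)) (fOf κ Φ t p O (KS.fT 0 fx)) σ') (σhF du)) (KS.RA' κ Φ t p O.merged 0) qB' (KS.RA' κ Φ t p O.merged 0) qB₃' (yLF' x du j ((prFA κ Φ t p O.merged (gOf κ Φ t p O (KS.gT 0 gx)) (fOf κ Φ t p O (KS.fT 0 fx))).ψ (φL κ Φ t p O.D O.DT O.ori (gOf κ Φ t p O (KS.gT 0 gx)) (fOf κ Φ t p O (KS.fT 0 fx))) t c')) (NrF' x du j ((prFA κ Φ t p O.merged (gOf κ Φ t p O (KS.gT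 0 gx)) (fOf κ Φ t p O (KS.fT 0 fx))).ψ (φL κ Φ t p O.D O.DT O.ori (gOf κ Φ t p O (KS.gT 0 gx)) (fOf κ Φ t p O (KS.fT 0 fx))) t c')) (N3F' x du j ((prFA κ Φ t p O.merged (gOf κ Φ t p O (KS.gT 0 gx)) (fOf κ Φ t p O (KS.fT 0 fx))).ψ (φL κ Φ t p O.D O.DT O.ori (gOf κ Φ t p O (KS.gT 0 gx)) (fOf κ Φ t p O (KS.fT 0 fx))) t c'))
      FY.hσT FY.FA1 FY.FA2 FY.FA3 FY.FA4 FY.FA5 FY.FA6 FY.FT1 FY.FT2 FY.FT3 FY.FT4 FY.FT5 FY.FT6 FY.FL1 FY.FL2 FY.FL3 FY.FL4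
      FY.hq₃ FY.hW FY.hxaY FY.hxbY FY.hclrLo FY.hclrHi FY.hclr₃ FY.hπ2Y FY.hπ3Y
  have HNX : ∀ a' x du j pc c' hI hj yF hyF hpc hbox hball hM hE, 0 + 1 + (Classical.choose (HX a' x du j pc c' hI hj yF hyF hpc hbox hball hM hE)).Nr + 1 + (Classical.choose (HX a' x du j pc c' hI hj yF hyF hpc hbox hball hM hE)).N₃ ≤ NegB.nFA κ.K₀ :=
    fun a' x du j pc c' hI hj yF hyF hpc hbox hball hM hE => by
    obtain ⟨e1, e2⟩ := Classical.choose_spec (HX a' x du j pc c' hI hj yF hyF hpc hbox hball hM hE)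
    rw [e1, e2]; have hc := hcapX x du j ((prFA κ Φ t p O.merged (gOf κ Φ t p O (KS.gT 0 gx)) (fOf κ Φ t p O (KS.fT 0 fx))).ψ (φL κ Φ t p O.D O.DT O.ori (gOf κ Φ t p O (KS.gT 0 gx)) (fOf κ Φ t p O (KS.fT 0 fx))) t c'); omega
  have HNY : ∀ a' x du j pc c' hI hj yF hyF hpc hbox hball hM hE, 0 + 1 + (Classical.choose (HY a' x du j pc c' hI hj yF hyF hpc hbox hball hM hE)).Nr + 1 + (Classical.choose (HY a' x du j pc c' hI hj yF hyF hpc hbox hball hM hE)).N₃ ≤ NegB.nFA κ.K₀ :=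
    fun a' x du j pc c' hI hj yF hyF hpc hbox hball hM hE => by
    obtain ⟨e1, e2⟩ := Classical.choose_spec (HY a' x du j pc c' hI hj yF hyF hpc hbox hball hM hE)
    rw [e1, e2]; have hc := hcapY x du j ((prFA κ Φ t p O.merged (gOf κ Φ t p O (KS.gT 0 gx)) (fOf κ Φ t p O (KS.fT 0 fx))).ψ (φL κ Φ t p O.D O.DT O.ori (gOf κ Φ t p O (KS.gT 0 gx)) (fOf κ Φ t p O (KS.fT 0 fx))) t c'); omega
  exact faceOblRM_negBTC₃t cF gx fx Px ex mx hAt hmx hex hSF16 hPx htr h1 hp0 hp1 σhF hσhF qB qB₃ qB' qB₃' hCF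
    (fun a' x du j pc c' hI hj yF hyF hpc hbox hball hM hE => Classical.choose (HX a' x du j pc c' hI hj yF hyF hpc hbox hball hM hE)) (fun a' x du j pc c' hI hj yF hyF hpc hbox hball hM hE => Classical.choose (HY a' x du j pc c' hI hj yF hyF hpc hbox hball hM hE)) HNX HNY

end NegB

end PlanarSkeletonNeg

end Summit.CriticalPhenomena.PercolationContinuityZ3.Theorems.Transplant

end
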